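import Literature.Probability.LatticeModels.ClusteringToTreeBound
import Literature.Probability.LatticeModels.WeightedTreeBoundCorrelations
import Literature.Probability.LatticeModels.UrsellFourCurrentsProofs
import Literature.Probability.LatticeModels.ImprovedTreeDiagramBoundSum
import HarnessLib

/-!
# The improved tree diagram bound from the intersection-clustering bound (Aizenman–Duminil-Copin 2021, Thm 1.3 ⇐ Prop. 6.1): the assembly

Topic `Literature/Probability/LatticeModels`; family `crit-ising`. Proof companion of
`ImprovedTreeDiagramBound` (the named fact `aizenmanDuminilCopin_improvedTreeDiagramBound` =
M. Aizenman, H. Duminil-Copin, *Marginal triviality of the scaling limits of critical 4D Ising and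
`φ⁴₄` models*, Ann. of Math. **194** (2021) = arXiv:1912.07973, **Theorem 1.3**). The printed
proof of Theorem 1.3 (§4.1, "Proof of Theorem 1.3", two displays; §6.1: "Choose `D` large enough
that the previous proposition holds true. We follow the same lines as in Section 4.1, simply noting
that since `B_{ℓ_k}(β) ≤ CD^k`, we may choose `K ≥ c log B_L(β)` with `2ℓ_K ≤ L` … so that (4.6)
implies the improved tree diagram bound") derives the theorem from ONE probabilistic input, the
intersection-clustering bound **Proposition 6.1** ("`P^{ux,uz,uy,ut}_β[M_u(𝒯; 𝓛, K) < δK] ≤ 2^{-δK}`"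
for the dynamic scales `ℓ_{k+1} = inf{ℓ : B_ℓ(β) ≥ D B_{ℓ_k}(β)}`), through the annular covering
Lemma 4.2, the switching lemma, (3.13)–(3.14) and the infrared bound. This file PROVES that
derivation, for the DLR states `μ ∈ 𝒢(β,0)` of the statement of the fact, with Prop. 6.1 read in
finite volume (free boundary condition in the boxes `Λ_n`, `n → ∞` — the random-current
representation of the tree is the finite-graph one) as an explicit hypothesis:

* `improvedTreeDiagramBound_of_boxClustering` — **Thm 1.3 ⇐ finite-volume Prop. 6.1**:
  `∃ D₀, ∀ D ≥ D₀, ∀ δ > 0, (finite-volume clustering bound with scales ℓ_k(β,D), rate 2^{-δK})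
  → aizenmanDuminilCopin_improvedTreeDiagramBound`.

No named fact is introduced (D-0026): the clustering bound enters as a hypothesis spelled in the
theorem, to be discharged by the proof of Prop. 6.1 (Lemma 6.2, Thm 6.4, Thm 5.12 of the paper).

## Contents

1. `Current.clusteringMassLT` — the clustering mass of `ClusteringToTreeBound` with a general
   threshold `θ` (`clusteringMass = clusteringMassLT (7r)`), monotone in `θ`, `≤ Z[yu]Z[xu]Z[tu]Z[zu]`;
   `Current.abs_ursell_ratio_le_clustering` — the §4.1 reduction (`Current.ursellInter_mul_sq_le` +
   `Current.ursellFour_currentSum_identity`) in ratio form: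
   `|U₄| ≤ 2∑_u (clusteringMassLT(7r)(u)/Z[∅]⁴ + 2^{-r} ∏ⱼ⟨σ_{xⱼ}σ_u⟩)`.
2. `abs_connectedFour_isingMeasure_le_clustering` — the same for the Ising model on a finite graph
   (`isingTwoPoint_free_eq_currentSum_div_holds`, `isingExpect_spinMonomial_four_eq`).
3. `finVolClusteringRatio Λ β ℓ K θ x y z t u = clusteringMassLT(θ)/Z_Λ[∅]⁴`
   `= ∏ⱼ⟨σ_uσ_{xⱼ}⟩_Λ · P^{ux,uz,uy,ut}_{Λ,β}[M_u(𝒯;ℓ,K) < θ]` for a finite `Λ ⊆ ℤ^d` (induced graph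
   `boxGraph Λ`, transport `isingExpect_free_map`); `abs_connectedFour_free_le_clustering` — the
   reduction in `Λ`; `finVolClusteringRatio_le_prod`.
4. `dynScale B D` — the scales `ℓ_k` of §6.1 (printed infimum; junk tail `2ℓ_k+1` once the infimum
   is over the empty set, as for `β < β_c`); doubling `two_mul_dynScale_lt_succ`, the bounds
   `apply_dynScale_le` (`B_{ℓ_k} ≤ (1 + C'/(D-1)) D^k`), `pow_le_apply_dynScale` (`D^k ≤ B_{ℓ_k}`),
   and the choice of `K` (`exists_dynScale_le_and_apply_le`: `2ℓ_K ≤ L`, infima exist below `K`,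
   `B_L ≤ M D^{K+1}`) — "it is a simple exercise to deduce that `D^k ≤ B_{ℓ_k}(β) ≤ CD^k`".
5. `exists_bubbleDiagram_increments` — `B_{n+1}, B_{2n} ≤ B_n + C'` uniformly in `0 ≤ β ≤ β_c(4)`
   from the infrared bound (`twoPointFree_criticalBeta_upper_holds`, Griffiths monotonicity).
6. `abs_connectedFour_le_of_boxClustering` — the passage `Λ_n ↑ ℤ⁴` (uniqueness of `𝒢(β,0)`,
   box limits of spin monomials, `0 ≤ ⟨σ_uσ_x⟩^∅_{Λ_n} ≤ ⟨σ_uσ_x⟩_μ`, tail of the series), as in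
   the tree's `abs_connectedFour_le_treeSum_free` for the plain bound.
7. `improvedTreeDiagramBound_of_boxClustering` — the assembly (`r = ⌊δK/7⌋`, the constant `7` of
   the tree's covering lemma; `c = δ log 2/(7 log D)`; the plain tree diagram bound
   `aizenman_treeDiagramBound_three_le` when `K ≤ 3`).

## References

* M. Aizenman, H. Duminil-Copin, Ann. of Math. 194 (2021), arXiv:1912.07973: Thm 1.3 (p. 6), §4.1
  (Lemma 4.2, proof of Thm 1.3 under (4.1), displays (4.5)–(4.6)), §6.1 (definition of `ℓ_k`,
  `D^k ≤ B_{ℓ_k} ≤ CD^k`, Prop. 6.1, proof of Thm 1.3), Appendix A.2 ("we work with finite `Λ` and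
  then take the limit") [AizenmanDuminilCopinAnnals2021].

## Mathlib

`tsum`/`Summable.hasSum`, `Filter.tendsto_atTop`, `Finset.eventually_all`,
`ge_of_tendsto'`, `Nat.find`, `Nat.findGreatest`, `Real.rpow`/`Real.log`. No Ising model, random
currents or bubble diagram in Mathlib.
-/

noncomputable section

open MeasureTheory Finset Filter Topology
open scoped symmDiff ENNReal

namespace Literature.Probability.LatticeModels

/-! ### Part 1. The clustering mass with a general threshold, on a finite graph -/

namespace Current

variable {V : Type*} [Fintype V] [DecidableEq V] {G : SimpleGraph V} [DecidableRel G.Adj]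
variable {K : G.edgeFinset → ℝ}

/-- The clustering mass at `u` with threshold `θ`: the un-normalised mass, under the four currents
`P^{uy,ux} ⊗ P^{ut,uz}` (`= P^{ux,uz,uy,ut}`), of the event that the intersection
`𝒯 = C_{n₁+n₃}(u) ∩ C_{n₂+n₄}(u)` of the two clusters of `u` occupies fewer than `θ` of the annuli
`u + Ann(ℓ_k, ℓ_{k+1})`, `k ≤ K_s`:
`∑ 1{yu}1{xu}1{tu}1{zu} w⁴ 𝟙[M_u(𝒯; ℓ, K_s) < θ]` — the quantity bounded by the
intersection-clustering bound (ADC Prop. 6.1, "`P^{ux,uz,uy,ut}_β[M_u(𝒯; 𝓛, K) < δK] ≤ 2^{-δK}`")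
after normalisation by `Z[yu]Z[xu]Z[tu]Z[zu]`. The tree's `Current.clusteringMass K ℓ K_s r` is the
case `θ = 7r`. [cite: AizenmanDuminilCopinAnnals2021, arXiv:1912.07973 §6.1, Prop. 6.1 (the event M_u(𝒯;𝓛,K) < δK)] -/
def clusteringMassLT [PseudoMetricSpace V] (K : G.edgeFinset → ℝ) (ℓ : ℕ → ℕ) (Ks θ : ℕ)
    (x y z t u : V) : ℝ≥0∞ :=
  ∑' pq : (Current G × Current G) × (Current G × Current G),
    epairWeight K ({y} ∆ {u}) ({x} ∆ {u}) pq.1 * epairWeight K ({t} ∆ {u}) ({z} ∆ {u}) pq.2 *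
      (if annulusCount ℓ Ks ((pq.1.1 + pq.1.2).cluster u ∩ (pq.2.1 + pq.2.2).cluster u) u < θ
        then 1 else 0)

/-- `clusteringMass K ℓ K_s r = clusteringMassLT K ℓ K_s (7r)`. [folklore] -/
theorem clusteringMass_eq_clusteringMassLT [PseudoMetricSpace V] (K : G.edgeFinset → ℝ) (ℓ : ℕ → ℕ)
    (Ks r : ℕ) (x y z t u : V) :
    clusteringMass K ℓ Ks r x y z t u = clusteringMassLT K ℓ Ks (7 * r) x y z t u := rfl

/-- Monotonicity of the clustering mass in the threshold. [folklore] -/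
theorem clusteringMassLT_mono [PseudoMetricSpace V] (K : G.edgeFinset → ℝ) (ℓ : ℕ → ℕ) (Ks : ℕ)
    {θ θ' : ℕ} (h : θ ≤ θ') (x y z t u : V) :
    clusteringMassLT K ℓ Ks θ x y z t u ≤ clusteringMassLT K ℓ Ks θ' x y z t u := by
  unfold clusteringMassLT
  refine ENNReal.tsum_le_tsum fun pq => mul_le_mul' le_rfl ?_
  split_ifs with h1 h2
  · exact le_rfl
  · exact absurd (lt_of_lt_of_le h1 h) h2
  · exact zero_le
  · exact le_rfl

/-- The clustering mass is at most the total mass `Z[yu]Z[xu] · Z[tu]Z[zu]` (the indicator is at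
most `1`). [folklore] -/
theorem clusteringMassLT_le_prod [PseudoMetricSpace V] (K : G.edgeFinset → ℝ) (ℓ : ℕ → ℕ) (Ks θ : ℕ)
    (x y z t u : V) :
    clusteringMassLT K ℓ Ks θ x y z t u ≤
      ecurrentSum K ({y} ∆ {u}) * ecurrentSum K ({x} ∆ {u}) *
        (ecurrentSum K ({t} ∆ {u}) * ecurrentSum K ({z} ∆ {u})) := by
  unfold clusteringMassLT
  calc ∑' pq : (Current G × Current G) × (Current G × Current G),
        epairWeight K ({y} ∆ {u}) ({x} ∆ {u}) pq.1 * epairWeight K ({t} ∆ {u}) ({z} ∆ {u}) pq.2 *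
          (if annulusCount ℓ Ks ((pq.1.1 + pq.1.2).cluster u ∩ (pq.2.1 + pq.2.2).cluster u) u < θ
            then 1 else 0)
      ≤ ∑' pq : (Current G × Current G) × (Current G × Current G),
          epairWeight K ({y} ∆ {u}) ({x} ∆ {u}) pq.1 * epairWeight K ({t} ∆ {u}) ({z} ∆ {u}) pq.2 := by
        refine ENNReal.tsum_le_tsum fun pq => ?_
        calc _ ≤ epairWeight K ({y} ∆ {u}) ({x} ∆ {u}) pq.1 * epairWeight K ({t} ∆ {u}) ({z} ∆ {u}) pq.2 * 1 :=
              mul_le_mul' le_rfl (by split_ifs <;> simp)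
          _ = _ := mul_one _
    _ = (∑' p : Current G × Current G, epairWeight K ({y} ∆ {u}) ({x} ∆ {u}) p) *
          ∑' q : Current G × Current G, epairWeight K ({t} ∆ {u}) ({z} ∆ {u}) q := by
        rw [tsum_mul_tsum_eq_tsum_prod]
    _ = _ := by rw [tsum_epairWeight, tsum_epairWeight]

/-- **The §4.1 reduction in ratio form.** For couplings `K ≥ 0` on a finite graph whose vertex type
carries a pseudo-metric, with `⟨σ_A⟩ := Z_K[A]/Z_K[∅]`, a doubling scale sequence (`1 ≤ ℓ₁`,
`2ℓ_k ≤ ℓ_{k+1}`), any `K_s` and `r`: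
`|U₄(x,y,z,t)| ≤ 2 ∑_u ( clusteringMassLT(7r)(u) / Z[∅]⁴ + 2^{-r} ⟨σ_xσ_u⟩⟨σ_yσ_u⟩⟨σ_zσ_u⟩⟨σ_tσ_u⟩ )`
(Aizenman–Duminil-Copin 2021, §4.1, the two displays of the proof of Thm 1.3 and "Adding …",
combined with (3.13)–(3.14); the tree's `Current.ursellInter_mul_sq_le` divided by `Z[∅]⁴`).
[cite: AizenmanDuminilCopinAnnals2021, arXiv:1912.07973 §4.1, proof of Thm 1.3 (the two displays, "Adding …")] -/
theorem abs_ursell_ratio_le_clustering [PseudoMetricSpace V] (hK : ∀ e, 0 ≤ K e) {ℓ : ℕ → ℕ}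
    (h1 : 1 ≤ ℓ 1) (h2 : ∀ k, 2 * ℓ k ≤ ℓ (k + 1)) (Ks r : ℕ) (x y z t : V) :
    |wcurrentSum K ({x} ∆ ({y} ∆ ({z} ∆ {t}))) / wcurrentSum K ∅ -
        wcurrentSum K ({x} ∆ {y}) / wcurrentSum K ∅ * (wcurrentSum K ({z} ∆ {t}) / wcurrentSum K ∅) -
        wcurrentSum K ({x} ∆ {z}) / wcurrentSum K ∅ * (wcurrentSum K ({y} ∆ {t}) / wcurrentSum K ∅) -
        wcurrentSum K ({x} ∆ {t}) / wcurrentSum K ∅ * (wcurrentSum K ({y} ∆ {z}) / wcurrentSum K ∅)| ≤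
      2 * ∑ u, ((clusteringMassLT K ℓ Ks (7 * r) x y z t u).toReal / wcurrentSum K ∅ ^ 4 +
        (1 / 2 ^ r) * (wcurrentSum K ({x} ∆ {u}) / wcurrentSum K ∅ * (wcurrentSum K ({y} ∆ {u}) / wcurrentSum K ∅) *
          (wcurrentSum K ({z} ∆ {u}) / wcurrentSum K ∅) * (wcurrentSum K ({t} ∆ {u}) / wcurrentSum K ∅))) := by
  set W : Finset V → ℝ := fun A => wcurrentSum K A with hW
  have hW' : ∀ A, (ecurrentSum K A).toReal = W A := fun A => toReal_ecurrentSum hK A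
  have hW0 : 0 < W ∅ := wcurrentSum_empty_pos hK
  have hWnn : ∀ A, 0 ≤ W A := fun A => wcurrentSum_nonneg hK A
  have hZtop : ∀ A, ecurrentSum K A ≠ ∞ := fun A => ecurrentSum_ne_top hK A
  -- the intersection term `P` and its finiteness
  set Pe : ℝ≥0∞ := ∑' p : Current G × Current G,
    epairWeight K ({x} ∆ {y}) ({z} ∆ {t}) p * (if z ∈ (p.1 + p.2).cluster x then 1 else 0) with hPe
  have hPle : Pe ≤ ecurrentSum K ({x} ∆ {y}) * ecurrentSum K ({z} ∆ {t}) := by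
    rw [← tsum_epairWeight]
    refine ENNReal.tsum_le_tsum fun p => ?_
    calc epairWeight K ({x} ∆ {y}) ({z} ∆ {t}) p * (if z ∈ (p.1 + p.2).cluster x then 1 else 0)
        ≤ epairWeight K ({x} ∆ {y}) ({z} ∆ {t}) p * 1 := mul_le_mul' le_rfl (by split_ifs <;> simp)
      _ = _ := mul_one _
  have hPtop : Pe ≠ ∞ := ne_top_of_le_ne_top (ENNReal.mul_ne_top (hZtop _) (hZtop _)) hPle
  set p : ℝ := Pe.toReal with hp
  have hp0 : 0 ≤ p := ENNReal.toReal_nonneg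
  -- the identity in `ℝ`
  have hid := congrArg ENNReal.toReal (Current.ursellFour_currentSum_identity hK x y z t)
  rw [ENNReal.toReal_add (ENNReal.add_ne_top.2 ⟨ENNReal.mul_ne_top (hZtop _) (hZtop _),
      ENNReal.mul_ne_top (hZtop _) (hZtop _)⟩) (ENNReal.mul_ne_top (hZtop _) (hZtop _)),
    ENNReal.toReal_add (ENNReal.mul_ne_top (hZtop _) (hZtop _)) (ENNReal.mul_ne_top (hZtop _) (hZtop _)),
    ENNReal.toReal_add (ENNReal.mul_ne_top (hZtop _) (hZtop _)) (ENNReal.mul_ne_top (by simp) hPtop)] at hid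
  simp only [ENNReal.toReal_mul, ENNReal.toReal_ofNat, hW'] at hid
  -- the clustering masses and the tree mass are finite
  have hCMtop : ∀ u, clusteringMassLT K ℓ Ks (7 * r) x y z t u ≠ ∞ := fun u =>
    ne_top_of_le_ne_top (ENNReal.mul_ne_top (ENNReal.mul_ne_top (hZtop _) (hZtop _))
      (ENNReal.mul_ne_top (hZtop _) (hZtop _))) (clusteringMassLT_le_prod K ℓ Ks _ x y z t u)
  have hTMtop : treeMass K x y z t ≠ ∞ := by
    refine ENNReal.sum_ne_top.2 fun u _ => ?_
    exact ENNReal.mul_ne_top (ENNReal.mul_ne_top (hZtop _) (hZtop _)) (ENNReal.mul_ne_top (hZtop _) (hZtop _))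
  -- the bound in `ℝ`
  have hbdE := Current.ursellInter_mul_sq_le hK h1 h2 Ks r x y z t
  have hbd := ENNReal.toReal_mono (ENNReal.add_ne_top.2 ⟨ENNReal.sum_ne_top.2 fun u _ => ?_,
      ENNReal.div_ne_top hTMtop (by positivity)⟩) hbdE
  swap
  · rw [clusteringMass_eq_clusteringMassLT]; exact hCMtop u
  rw [ENNReal.toReal_mul, ENNReal.toReal_pow, ENNReal.toReal_add (ENNReal.sum_ne_top.2 fun u _ => by
      rw [clusteringMass_eq_clusteringMassLT]; exact hCMtop u) (ENNReal.div_ne_top hTMtop (by positivity)),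
    ENNReal.toReal_sum (fun u _ => by rw [clusteringMass_eq_clusteringMassLT]; exact hCMtop u),
    ENNReal.toReal_div, ENNReal.toReal_pow, ENNReal.toReal_ofNat] at hbd
  simp only [treeMass, ENNReal.toReal_sum (fun u _ =>
    ENNReal.mul_ne_top (ENNReal.mul_ne_top (hZtop _) (hZtop _)) (ENNReal.mul_ne_top (hZtop _) (hZtop _))),
    ENNReal.toReal_mul, hW', clusteringMass_eq_clusteringMassLT] at hbd
  -- `hid : Wxy Wzt + Wxz Wyt + Wxt Wyz = WD W∅ + 2 p`,
  -- `hbd : p W∅² ≤ ∑ cm u + (∑ Wyu Wxu (Wtu Wzu)) / 2^r`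
  change |W _ / W ∅ - W _ / W ∅ * (W _ / W ∅) - W _ / W ∅ * (W _ / W ∅) - W _ / W ∅ * (W _ / W ∅)| ≤
    2 * ∑ u, ((clusteringMassLT K ℓ Ks (7 * r) x y z t u).toReal / W ∅ ^ 4 +
      (1 / 2 ^ r) * (W _ / W ∅ * (W _ / W ∅) * (W _ / W ∅) * (W _ / W ∅)))
  have hL : W ({x} ∆ ({y} ∆ ({z} ∆ {t}))) / W ∅ - W ({x} ∆ {y}) / W ∅ * (W ({z} ∆ {t}) / W ∅) -
      W ({x} ∆ {z}) / W ∅ * (W ({y} ∆ {t}) / W ∅) - W ({x} ∆ {t}) / W ∅ * (W ({y} ∆ {z}) / W ∅) =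
      -(2 * (p * W ∅ ^ 2) / W ∅ ^ 4) := by
    field_simp
    rw [← hp] at hid
    nlinarith [hid]
  have hR : ∑ u, ((clusteringMassLT K ℓ Ks (7 * r) x y z t u).toReal / W ∅ ^ 4 +
      (1 / 2 ^ r) * (W ({x} ∆ {u}) / W ∅ * (W ({y} ∆ {u}) / W ∅) * (W ({z} ∆ {u}) / W ∅) * (W ({t} ∆ {u}) / W ∅))) =
      (∑ u, (clusteringMassLT K ℓ Ks (7 * r) x y z t u).toReal +
        (∑ u, W ({y} ∆ {u}) * W ({x} ∆ {u}) * (W ({t} ∆ {u}) * W ({z} ∆ {u}))) / 2 ^ r) / W ∅ ^ 4 := by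
    rw [Finset.sum_add_distrib, add_div, Finset.sum_div, Finset.sum_div, Finset.sum_div]
    congr 1
    refine Finset.sum_congr rfl fun u _ => ?_
    field_simp
  rw [hL, hR, abs_neg, abs_of_nonneg (by positivity), mul_div_assoc]
  refine mul_le_mul_of_nonneg_left (div_le_div_of_nonneg_right ?_ (by positivity)) (by norm_num)
  rw [← hp] at hbd
  exact hbd

end Current

/-! ### Part 2. The Ising model on a finite graph -/

section FiniteGraph

variable {V : Type*} [Fintype V] [DecidableEq V] (G : SimpleGraph V) [DecidableRel G.Adj]

/-- **The §4.1 reduction for the Ising model on a finite graph** (uniform coupling `β ≥ 0`, free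
boundary condition, zero field): for a doubling scale sequence, any `K_s`, `r` and `x : Fin 4 → V`,
`|U₄(x)| ≤ 2 ∑_u ( clusteringMassLT(7r)(x₀,x₁,x₂,x₃;u) / Z[∅]⁴ + 2^{-r} ∏ⱼ ⟨σ_uσ_{xⱼ}⟩ )`.
[cite: AizenmanDuminilCopinAnnals2021, arXiv:1912.07973 §4.1, proof of Thm 1.3 (the two displays, "Adding …")] -/
theorem abs_connectedFour_isingMeasure_le_clustering [PseudoMetricSpace V] {β : ℝ} (hβ : 0 ≤ β)
    {ℓ : ℕ → ℕ} (h1 : 1 ≤ ℓ 1) (h2 : ∀ k, 2 * ℓ k ≤ ℓ (k + 1)) (Ks r : ℕ) (x : Fin 4 → V) :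
    |connectedFour (isingMeasure G univ β 0 .free) spinAt x| ≤
      2 * ∑ u, ((Current.clusteringMassLT (G := G) (fun _ => β) ℓ Ks (7 * r) (x 0) (x 1) (x 2) (x 3) u).toReal /
          currentSum G β ∅ ^ 4 +
        (1 / 2 ^ r) * ∏ j, isingTwoPoint G univ β 0 .free u (x j)) := by
  have hK : ∀ e : G.edgeFinset, 0 ≤ (fun _ : G.edgeFinset => β) e := fun _ => hβ
  have h := Current.abs_ursell_ratio_le_clustering (G := G) (K := fun _ : G.edgeFinset => β) hK h1 h2 Ks r
    (x 0) (x 1) (x 2) (x 3)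
  -- the four-point function
  have hmono : spinMonomial x = spinMonomial ![x 0, x 1, x 2, x 3] := by
    funext σ
    simp [spinMonomial, Fin.prod_univ_four]
  have h4 : nPoint (isingMeasure G univ β 0 .free) spinAt x =
      wcurrentSum (fun _ : G.edgeFinset => β) ({x 0} ∆ ({x 1} ∆ ({x 2} ∆ {x 3}))) /
        wcurrentSum (fun _ : G.edgeFinset => β) ∅ := by
    rw [nPoint_isingMeasure, hmono, isingExpect_spinMonomial_four_eq, currentSum_eq_wcurrentSum,
      currentSum_eq_wcurrentSum]
  -- the two-point functions
  have h2pt : ∀ a b : V, isingTwoPoint G univ β 0 .free a b =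
      wcurrentSum (fun _ : G.edgeFinset => β) ({a} ∆ {b}) / wcurrentSum (fun _ : G.edgeFinset => β) ∅ := by
    intro a b
    rw [isingTwoPoint_free_eq_currentSum_div_holds, currentSum_eq_wcurrentSum, currentSum_eq_wcurrentSum]
  have h2pt' : ∀ a b : V, twoPoint (isingMeasure G univ β 0 .free) spinAt a b =
      wcurrentSum (fun _ : G.edgeFinset => β) ({a} ∆ {b}) / wcurrentSum (fun _ : G.edgeFinset => β) ∅ := by
    intro a b
    rw [twoPoint_isingMeasure, h2pt]
  rw [connectedFour, h4, h2pt', h2pt', h2pt', h2pt', h2pt', h2pt']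
  refine h.trans (le_of_eq ?_)
  congr 1
  refine Finset.sum_congr rfl fun u _ => ?_
  rw [currentSum_eq_wcurrentSum, Fin.prod_univ_four, h2pt, h2pt, h2pt, h2pt, symmDiff_comm ({u} : Finset V) {x 0},
    symmDiff_comm ({u} : Finset V) {x 1}, symmDiff_comm ({u} : Finset V) {x 2},
    symmDiff_comm ({u} : Finset V) {x 3}]

/-- The normalised clustering mass is at most the product of the two-point functions:
`clusteringMassLT(θ)(x₀,…,x₃;u) / Z[∅]⁴ ≤ ∏ⱼ ⟨σ_uσ_{xⱼ}⟩` (the indicator is at most `1`). [folklore] -/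
theorem clusteringMassLT_toReal_div_le [PseudoMetricSpace V] {β : ℝ} (hβ : 0 ≤ β)
    (ℓ : ℕ → ℕ) (Ks θ : ℕ) (x : Fin 4 → V) (u : V) :
    (Current.clusteringMassLT (G := G) (fun _ => β) ℓ Ks θ (x 0) (x 1) (x 2) (x 3) u).toReal /
        currentSum G β ∅ ^ 4 ≤
      ∏ j, isingTwoPoint G univ β 0 .free u (x j) := by
  have hK : ∀ e : G.edgeFinset, 0 ≤ (fun _ : G.edgeFinset => β) e := fun _ => hβ
  set W : Finset V → ℝ := fun A => wcurrentSum (fun _ : G.edgeFinset => β) A with hW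
  have hW' : ∀ A, (ecurrentSum (fun _ : G.edgeFinset => β) A).toReal = W A := fun A => toReal_ecurrentSum hK A
  have hW0 : 0 < W ∅ := wcurrentSum_empty_pos hK
  have hZtop : ∀ A, ecurrentSum (fun _ : G.edgeFinset => β) A ≠ ∞ := fun A => ecurrentSum_ne_top hK A
  have h2pt : ∀ a b : V, isingTwoPoint G univ β 0 .free a b = W ({a} ∆ {b}) / W ∅ := by
    intro a b
    rw [isingTwoPoint_free_eq_currentSum_div_holds, currentSum_eq_wcurrentSum, currentSum_eq_wcurrentSum]
  have hle := ENNReal.toReal_mono (ENNReal.mul_ne_top (ENNReal.mul_ne_top (hZtop _) (hZtop _))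
      (ENNReal.mul_ne_top (hZtop _) (hZtop _)))
    (Current.clusteringMassLT_le_prod (G := G) (fun _ : G.edgeFinset => β) ℓ Ks θ (x 0) (x 1) (x 2) (x 3) u)
  simp only [ENNReal.toReal_mul, hW'] at hle
  rw [currentSum_eq_wcurrentSum, Fin.prod_univ_four, h2pt, h2pt, h2pt, h2pt,
    symmDiff_comm ({u} : Finset V) {x 0}, symmDiff_comm ({u} : Finset V) {x 1},
    symmDiff_comm ({u} : Finset V) {x 2}, symmDiff_comm ({u} : Finset V) {x 3}]
  change _ / W ∅ ^ 4 ≤ W _ / W ∅ * (W _ / W ∅) * (W _ / W ∅) * (W _ / W ∅)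
  rw [show W ({x 0} ∆ {u}) / W ∅ * (W ({x 1} ∆ {u}) / W ∅) * (W ({x 2} ∆ {u}) / W ∅) * (W ({x 3} ∆ {u}) / W ∅) =
    (W ({x 1} ∆ {u}) * W ({x 0} ∆ {u}) * (W ({x 3} ∆ {u}) * W ({x 2} ∆ {u}))) / W ∅ ^ 4 by
      field_simp]
  exact div_le_div_of_nonneg_right hle (by positivity)

/-- Non-negativity of the normalised clustering mass. [folklore] -/
theorem clusteringMassLT_toReal_div_nonneg [PseudoMetricSpace V] {β : ℝ} (hβ : 0 ≤ β)
    (ℓ : ℕ → ℕ) (Ks θ : ℕ) (x y z t u : V) :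
    0 ≤ (Current.clusteringMassLT (G := G) (fun _ => β) ℓ Ks θ x y z t u).toReal / currentSum G β ∅ ^ 4 :=
  div_nonneg ENNReal.toReal_nonneg (pow_nonneg (currentSum_nonneg G hβ ∅) 4)

end FiniteGraph

/-! ### Part 3. Finite volumes of `ℤ^d`, free boundary condition -/

section FiniteVolume

variable {d : ℕ}

/-- The induced nearest-neighbour graph on a finite `Λ ⊆ ℤ^d` (vertex type `↥Λ`). [folklore] -/
abbrev boxGraph (Λ : Finset (Site d)) : SimpleGraph ↥Λ :=
  (zdGraph d).comap (Function.Embedding.subtype fun x => x ∈ Λ)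

/-- **The normalised clustering mass in a finite volume `Λ ⊆ ℤ^d`** (free boundary condition,
coupling `β`, zero field): for `x, y, z, t, u ∈ Λ`,
`finVolClusteringRatio Λ β ℓ K_s θ x y z t u = clusteringMassLT(θ)(x,y,z,t;u) / Z_Λ[∅]⁴`
`= ⟨σ_uσ_x⟩_Λ⟨σ_uσ_y⟩_Λ⟨σ_uσ_z⟩_Λ⟨σ_uσ_t⟩_Λ · P^{ux,uz,uy,ut}_{Λ,β}[M_u(𝒯; ℓ, K_s) < θ]`
(the finite-volume reading of the left side of ADC Prop. 6.1, multiplied by the four two-point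
functions; annuli in the sup-norm metric of `ℤ^d`); junk value `0` if one of the points is not in
`Λ`. [cite: AizenmanDuminilCopinAnnals2021, arXiv:1912.07973 §6.1, Prop. 6.1 (finite-volume reading)] -/
def finVolClusteringRatio (Λ : Finset (Site d)) (β : ℝ) (ℓ : ℕ → ℕ) (Ks θ : ℕ)
    (x y z t u : Site d) : ℝ :=
  if h : x ∈ Λ ∧ y ∈ Λ ∧ z ∈ Λ ∧ t ∈ Λ ∧ u ∈ Λ then
    (Current.clusteringMassLT (G := boxGraph Λ) (fun _ => β) ℓ Ks θ ⟨x, h.1⟩ ⟨y, h.2.1⟩ ⟨z, h.2.2.1⟩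
        ⟨t, h.2.2.2.1⟩ ⟨u, h.2.2.2.2⟩).toReal / currentSum (boxGraph Λ) β ∅ ^ 4
  else 0

/-- `finVolClusteringRatio ≥ 0` for `β ≥ 0`. [folklore] -/
theorem finVolClusteringRatio_nonneg (Λ : Finset (Site d)) {β : ℝ} (hβ : 0 ≤ β) (ℓ : ℕ → ℕ)
    (Ks θ : ℕ) (x y z t u : Site d) : 0 ≤ finVolClusteringRatio Λ β ℓ Ks θ x y z t u := by
  unfold finVolClusteringRatio
  split_ifs with h
  · exact clusteringMassLT_toReal_div_nonneg _ hβ ℓ Ks θ _ _ _ _ _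
  · exact le_rfl

/-- Monotonicity of `finVolClusteringRatio` in the threshold. [folklore] -/
theorem finVolClusteringRatio_mono (Λ : Finset (Site d)) {β : ℝ} (hβ : 0 ≤ β) (ℓ : ℕ → ℕ)
    (Ks : ℕ) {θ θ' : ℕ} (hθ : θ ≤ θ') (x y z t u : Site d) :
    finVolClusteringRatio Λ β ℓ Ks θ x y z t u ≤ finVolClusteringRatio Λ β ℓ Ks θ' x y z t u := by
  unfold finVolClusteringRatio
  split_ifs with h
  · have hK : ∀ e : (boxGraph Λ).edgeFinset, 0 ≤ (fun _ : (boxGraph Λ).edgeFinset => β) e := fun _ => hβ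
    have hZtop : ∀ A, ecurrentSum (fun _ : (boxGraph Λ).edgeFinset => β) A ≠ ∞ := fun A =>
      ecurrentSum_ne_top hK A
    refine div_le_div_of_nonneg_right (ENNReal.toReal_mono ?_
      (Current.clusteringMassLT_mono _ ℓ Ks hθ _ _ _ _ _)) (pow_nonneg (currentSum_nonneg _ hβ ∅) 4)
    exact ne_top_of_le_ne_top (ENNReal.mul_ne_top (ENNReal.mul_ne_top (hZtop _) (hZtop _))
      (ENNReal.mul_ne_top (hZtop _) (hZtop _))) (Current.clusteringMassLT_le_prod _ ℓ Ks θ' _ _ _ _ _)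
  · exact le_rfl

/-- The free finite-volume two-point function of `Λ ⊆ ℤ^d` is that of the induced graph on `↥Λ`.
[folklore] -/
theorem isingTwoPoint_free_eq_boxGraph (Λ : Finset (Site d)) (β : ℝ) (a b : ↥Λ) :
    isingTwoPoint (zdGraph d) Λ β 0 .free (a : Site d) b = isingTwoPoint (boxGraph Λ) univ β 0 .free a b := by
  have hmapΛ : (Finset.univ : Finset ↥Λ).map (Function.Embedding.subtype fun x => x ∈ Λ) = Λ := by
    rw [Finset.univ_eq_attach, Finset.attach_map_val]
  have := isingTwoPoint_free_map (G := boxGraph Λ) (G' := zdGraph d)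
    (Function.Embedding.subtype fun x => x ∈ Λ) (Λ := Finset.univ) (fun a _ b _ => Iff.rfl) β 0 a b
  rw [hmapΛ] at this
  exact this

/-- The free finite-volume Ursell function of `Λ ⊆ ℤ^d` is that of the induced graph on `↥Λ`.
[folklore] -/
theorem connectedFour_free_eq_boxGraph (Λ : Finset (Site d)) (β : ℝ) (x : Fin 4 → Site d)
    (hx : ∀ i, x i ∈ Λ) :
    connectedFour (isingMeasure (zdGraph d) Λ β 0 .free) spinAt x =
      connectedFour (isingMeasure (boxGraph Λ) univ β 0 .free) spinAt (fun i => (⟨x i, hx i⟩ : ↥Λ)) := by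
  set φ : ↥Λ ↪ Site d := Function.Embedding.subtype fun x => x ∈ Λ with hφ
  have hmapΛ : (Finset.univ : Finset ↥Λ).map φ = Λ := by
    rw [Finset.univ_eq_attach, hφ, Finset.attach_map_val]
  set y : Fin 4 → ↥Λ := fun i => ⟨x i, hx i⟩ with hy
  have hE : ∀ {f : SpinConfig (Site d) → ℝ}, Measurable f →
      isingExpect (zdGraph d) Λ β 0 .free f =
        isingExpect (boxGraph Λ) Finset.univ β 0 .free (fun τ => f (SpinConfig.extendAlong φ τ)) := by
    intro f hf
    have h1 := isingExpect_free_map (G := boxGraph Λ) (G' := zdGraph d) φ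
      (Λ := Finset.univ) (fun a _ b _ => Iff.rfl) β 0 hf
    rw [hmapΛ] at h1
    exact h1
  have hn : nPoint (isingMeasure (zdGraph d) Λ β 0 .free) spinAt x =
      nPoint (isingMeasure (boxGraph Λ) Finset.univ β 0 .free) spinAt y := by
    change isingExpect (zdGraph d) Λ β 0 .free (fun σ => ∏ i, spinAt (x i) σ) =
      isingExpect (boxGraph Λ) Finset.univ β 0 .free (fun τ => ∏ i, spinAt (y i) τ)
    rw [hE (Finset.measurable_prod _ fun i _ => measurable_spinAt _)]
    congr 1
    funext τ
    refine Finset.prod_congr rfl fun i _ => ?_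
    exact spinAt_extendAlong φ τ (y i)
  have h2 : ∀ a b : ↥Λ, isingTwoPoint (zdGraph d) Λ β 0 .free (a : Site d) b =
      isingTwoPoint (boxGraph Λ) Finset.univ β 0 .free a b := isingTwoPoint_free_eq_boxGraph Λ β
  simp only [connectedFour, hn]
  have : ∀ i j, twoPoint (isingMeasure (zdGraph d) Λ β 0 .free) spinAt (x i) (x j) =
      twoPoint (isingMeasure (boxGraph Λ) Finset.univ β 0 .free) spinAt (y i) (y j) :=
    fun i j => h2 (y i) (y j)
  simp only [this]

/-- **The §4.1 reduction in a finite volume of `ℤ^d`, free boundary condition** (Aizenman–Duminil-Copin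
2021, §4.1 / §6.1, finite-volume form): for `β ≥ 0`, a finite `Λ ⊆ ℤ^d`, a doubling scale
sequence, any `K_s`, `r`, and `x₀, …, x₃ ∈ Λ`,
`|U₄^∅_{Λ;β}(x)| ≤ 2 ∑_{u ∈ Λ} ( finVolClusteringRatio(7r)(x;u) + 2^{-r} ∏ⱼ ⟨σ_uσ_{xⱼ}⟩^∅_{Λ;β} )`, i.e.
`|U₄| ≤ 2 ∑_u ∏ⱼ⟨σ_uσ_{xⱼ}⟩ (P^{ux₀,ux₂,ux₁,ux₃}_Λ[M_u(𝒯;ℓ,K_s) < 7r] + 2^{-r})`.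
[cite: AizenmanDuminilCopinAnnals2021, arXiv:1912.07973 §4.1, proof of Thm 1.3, and §6.1] -/
theorem abs_connectedFour_free_le_clustering {β : ℝ} (hβ : 0 ≤ β) (Λ : Finset (Site d))
    {ℓ : ℕ → ℕ} (h1 : 1 ≤ ℓ 1) (h2 : ∀ k, 2 * ℓ k ≤ ℓ (k + 1)) (Ks r : ℕ) (x : Fin 4 → Site d)
    (hx : ∀ i, x i ∈ Λ) :
    |connectedFour (isingMeasure (zdGraph d) Λ β 0 .free) spinAt x| ≤
      2 * ∑ u ∈ Λ, (finVolClusteringRatio Λ β ℓ Ks (7 * r) (x 0) (x 1) (x 2) (x 3) u +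
        (1 / 2 ^ r) * ∏ j, isingTwoPoint (zdGraph d) Λ β 0 .free u (x j)) := by
  set y : Fin 4 → ↥Λ := fun i => ⟨x i, hx i⟩ with hy
  rw [connectedFour_free_eq_boxGraph Λ β x hx]
  refine (abs_connectedFour_isingMeasure_le_clustering (boxGraph Λ) hβ h1 h2 Ks r y).trans (le_of_eq ?_)
  congr 1
  rw [← Finset.sum_coe_sort Λ]
  refine Finset.sum_congr rfl fun u _ => ?_
  have hxu : x 0 ∈ Λ ∧ x 1 ∈ Λ ∧ x 2 ∈ Λ ∧ x 3 ∈ Λ ∧ (u : Site d) ∈ Λ := ⟨hx 0, hx 1, hx 2, hx 3, u.2⟩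
  rw [finVolClusteringRatio, dif_pos hxu]
  congr 2
  exact Finset.prod_congr rfl fun j _ => (isingTwoPoint_free_eq_boxGraph Λ β u (y j)).symm

/-- The normalised clustering mass in a finite volume is at most the product of the two-point
functions: `finVolClusteringRatio(θ)(x;u) ≤ ∏ⱼ ⟨σ_uσ_{xⱼ}⟩^∅_{Λ;β}` for `x₀,…,x₃,u ∈ Λ`. [folklore] -/
theorem finVolClusteringRatio_le_prod {β : ℝ} (hβ : 0 ≤ β) (Λ : Finset (Site d)) (ℓ : ℕ → ℕ)
    (Ks θ : ℕ) (x : Fin 4 → Site d) (hx : ∀ i, x i ∈ Λ) {u : Site d} (hu : u ∈ Λ) :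
    finVolClusteringRatio Λ β ℓ Ks θ (x 0) (x 1) (x 2) (x 3) u ≤
      ∏ j, isingTwoPoint (zdGraph d) Λ β 0 .free u (x j) := by
  set y : Fin 4 → ↥Λ := fun i => ⟨x i, hx i⟩ with hy
  have hxu : x 0 ∈ Λ ∧ x 1 ∈ Λ ∧ x 2 ∈ Λ ∧ x 3 ∈ Λ ∧ u ∈ Λ := ⟨hx 0, hx 1, hx 2, hx 3, hu⟩
  rw [finVolClusteringRatio, dif_pos hxu]
  refine (clusteringMassLT_toReal_div_le (boxGraph Λ) hβ ℓ Ks θ y ⟨u, hu⟩).trans (le_of_eq ?_)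
  exact Finset.prod_congr rfl fun j _ => (isingTwoPoint_free_eq_boxGraph Λ β ⟨u, hu⟩ (y j)).symm

end FiniteVolume

/-! ### Part 4. The dynamic scale sequence `ℓ_k(β, D)` of §6.1 -/

section Scales

open Classical in
/-- **The dynamic scale sequence of Aizenman–Duminil-Copin 2021, §6.1**: for a function
`B : ℕ → ℝ` (the bubble diagram `B_ℓ(β)` at integer scales) and `D > 1`, "`ℓ₀ = 0` and
`ℓ_{k+1} = inf{ℓ : B_ℓ(β) ≥ D B_{ℓ_k}(β)}`" — "a (possibly finite) sequence": when the infimum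
is over the empty set (which happens for `β < β_c`, where `B_ℓ(β)` is bounded), the sequence is
continued by `ℓ_{k+1} = 2ℓ_k + 1` (a junk tail, never used: every statement below about the
`k`-th scale carries the hypothesis that the first `k` infima exist, or holds for both branches).
[cite: AizenmanDuminilCopinAnnals2021, arXiv:1912.07973 §6.1, definition of ℓ_k (display before Prop. 6.1)] -/
def dynScale (B : ℕ → ℝ) (D : ℝ) : ℕ → ℕ
  | 0 => 0
  | k + 1 =>
    if h : ∃ n : ℕ, D * B (dynScale B D k) ≤ B n then Nat.find h else 2 * dynScale B D k + 1

variable {B : ℕ → ℝ} {D : ℝ}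

/-- `ℓ₀ = 0`. [cite: AizenmanDuminilCopinAnnals2021, arXiv:1912.07973 §6.1, definition of ℓ_k] -/
@[simp] theorem dynScale_zero (B : ℕ → ℝ) (D : ℝ) : dynScale B D 0 = 0 := rfl

open Classical in
/-- The recursion, when the infimum exists: `ℓ_{k+1} = min{n : B_n ≥ D B_{ℓ_k}}`. [cite: AizenmanDuminilCopinAnnals2021, arXiv:1912.07973 §6.1, definition of ℓ_k] -/
theorem dynScale_succ_of_exists {k : ℕ} (h : ∃ n : ℕ, D * B (dynScale B D k) ≤ B n) :
    dynScale B D (k + 1) = Nat.find h := by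
  rw [dynScale, dif_pos h]

/-- The recursion, when the infimum does not exist (junk tail): `ℓ_{k+1} = 2ℓ_k + 1`. [folklore] -/
theorem dynScale_succ_of_not_exists {k : ℕ} (h : ¬ ∃ n : ℕ, D * B (dynScale B D k) ≤ B n) :
    dynScale B D (k + 1) = 2 * dynScale B D k + 1 := by
  rw [dynScale, dif_neg h]

/-- When the infimum exists, `B_{ℓ_{k+1}} ≥ D B_{ℓ_k}`. [cite: AizenmanDuminilCopinAnnals2021, arXiv:1912.07973 §6.1, definition of ℓ_k] -/
theorem mul_le_apply_dynScale_succ {k : ℕ} (h : ∃ n : ℕ, D * B (dynScale B D k) ≤ B n) :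
    D * B (dynScale B D k) ≤ B (dynScale B D (k + 1)) := by
  classical
  rw [dynScale_succ_of_exists h]
  exact Nat.find_spec h

/-- Minimality (both branches): `B_n < D B_{ℓ_k}` for every `n < ℓ_{k+1}`. [cite: AizenmanDuminilCopinAnnals2021, arXiv:1912.07973 §6.1, definition of ℓ_k] -/
theorem apply_lt_mul_of_lt_dynScale_succ {k n : ℕ} (hn : n < dynScale B D (k + 1)) :
    B n < D * B (dynScale B D k) := by
  classical
  by_cases h : ∃ m : ℕ, D * B (dynScale B D k) ≤ B m
  · rw [dynScale_succ_of_exists h] at hn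
    exact not_le.1 (Nat.find_min h hn)
  · push Not at h
    exact h n

/-- **Doubling.** If `B` is non-decreasing, `B ≥ 1`, `B_{2n} ≤ B_n + C'` for all `n` and
`D > 1 + C'`, then `2ℓ_k < ℓ_{k+1}` for every `k` (in the source: a consequence of the infrared
bound, "by the Infrared Bound, `B_L - B_ℓ ≤ C₀ log(L/ℓ)`"). [cite: AizenmanDuminilCopinAnnals2021, arXiv:1912.07973 §6.1, display D^k ≤ B_{ℓ_k} ≤ CD^k and its derivation] -/
theorem two_mul_dynScale_lt_succ (hmono : Monotone B) (hB1 : ∀ n, 1 ≤ B n) {C' : ℝ}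
    (hdouble : ∀ n, B (2 * n) ≤ B n + C') (hD : 1 + C' < D) (k : ℕ) :
    2 * dynScale B D k < dynScale B D (k + 1) := by
  classical
  by_cases h : ∃ m : ℕ, D * B (dynScale B D k) ≤ B m
  · by_contra hle
    push Not at hle
    have h1 := mul_le_apply_dynScale_succ h
    have h2 : B (dynScale B D (k + 1)) ≤ B (2 * dynScale B D k) := hmono hle
    have h3 := hdouble (dynScale B D k)
    have h4 : 0 ≤ B (dynScale B D k) - 1 := sub_nonneg.2 (hB1 _)
    have hC' : 0 ≤ C' := by
      have := hdouble 0
      simp only [mul_zero] at this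
      linarith
    nlinarith
  · rw [dynScale_succ_of_not_exists h]
    exact Nat.lt_succ_self _

/-- Under the doubling hypotheses, `2ℓ_k ≤ ℓ_{k+1}` and `1 ≤ ℓ₁` — the hypotheses of the annular
covering lemma (`AnnularCovering.lean`). [folklore] -/
theorem dynScale_doubling (hmono : Monotone B) (hB1 : ∀ n, 1 ≤ B n) {C' : ℝ}
    (hdouble : ∀ n, B (2 * n) ≤ B n + C') (hD : 1 + C' < D) :
    1 ≤ dynScale B D 1 ∧ ∀ k, 2 * dynScale B D k ≤ dynScale B D (k + 1) :=
  ⟨by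
    have h := two_mul_dynScale_lt_succ hmono hB1 hdouble hD 0
    rw [dynScale_zero, mul_zero, zero_add] at h
    exact Nat.one_le_iff_ne_zero.2 (Nat.pos_iff_ne_zero.1 h),
    fun k => (two_mul_dynScale_lt_succ hmono hB1 hdouble hD k).le⟩

/-- Under the doubling hypotheses the scales grow at least geometrically: `k ≤ ℓ_k`
(indeed `2^k - 1 ≤ ℓ_k`; the linear bound is what is used). [folklore] -/
theorem le_dynScale (hmono : Monotone B) (hB1 : ∀ n, 1 ≤ B n) {C' : ℝ}
    (hdouble : ∀ n, B (2 * n) ≤ B n + C') (hD : 1 + C' < D) (k : ℕ) : k ≤ dynScale B D k := by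
  induction k with
  | zero => simp
  | succ k ih =>
    have := two_mul_dynScale_lt_succ hmono hB1 hdouble hD k
    omega

/-- **The upper bound `B_{ℓ_k} ≤ C D^k`** ("it is a simple exercise to deduce that …
`D^k ≤ B_{ℓ_k}(β) ≤ C D^k`"): if moreover `B_{n+1} ≤ B_n + C'` for all `n` and `B₀ = 1`, then
`B_{ℓ_k} ≤ (1 + C'/(D-1)) D^k` for every `k` (both branches). [cite: AizenmanDuminilCopinAnnals2021, arXiv:1912.07973 §6.1, display D^k ≤ B_{ℓ_k} ≤ CD^k] -/
theorem apply_dynScale_le (hmono : Monotone B) (hB1 : ∀ n, 1 ≤ B n) (hB0 : B 0 = 1) {C' : ℝ}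
    (hstep : ∀ n, B (n + 1) ≤ B n + C') (hdouble : ∀ n, B (2 * n) ≤ B n + C') (hD : 1 + C' < D)
    (k : ℕ) : B (dynScale B D k) ≤ (1 + C' / (D - 1)) * D ^ k := by
  classical
  have hC' : 0 ≤ C' := by
    have := hdouble 0
    simp only [mul_zero] at this
    linarith
  have hD1 : 1 < D := by linarith
  have hD0 : 0 < D - 1 := sub_pos.2 hD1
  -- one step of the recursion: `B_{ℓ_{k+1}} ≤ D B_{ℓ_k} + C'`
  have hrec : ∀ k, B (dynScale B D (k + 1)) ≤ D * B (dynScale B D k) + C' := by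
    intro k
    by_cases h : ∃ m : ℕ, D * B (dynScale B D k) ≤ B m
    · have hpos : 0 < dynScale B D (k + 1) :=
        lt_of_le_of_lt (Nat.zero_le _) (two_mul_dynScale_lt_succ hmono hB1 hdouble hD k)
      obtain ⟨m, hm⟩ : ∃ m, dynScale B D (k + 1) = m + 1 := ⟨dynScale B D (k + 1) - 1, by omega⟩
      have hlt : B m < D * B (dynScale B D k) :=
        apply_lt_mul_of_lt_dynScale_succ (by omega)
      calc B (dynScale B D (k + 1)) = B (m + 1) := by rw [hm]
        _ ≤ B m + C' := hstep m
        _ ≤ D * B (dynScale B D k) + C' := by linarith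
    · -- junk branch: every `n` fails, in particular `n = ℓ_{k+1}`
      push Not at h
      have := h (dynScale B D (k + 1))
      linarith
  -- induction with the invariant `B_{ℓ_k} + C'/(D-1) ≤ (1 + C'/(D-1)) D^k`
  have key : ∀ k, B (dynScale B D k) + C' / (D - 1) ≤ (1 + C' / (D - 1)) * D ^ k := by
    intro k
    induction k with
    | zero => simp [hB0]
    | succ k ih =>
      calc B (dynScale B D (k + 1)) + C' / (D - 1)
          ≤ D * B (dynScale B D k) + C' + C' / (D - 1) := by linarith [hrec k]
        _ = D * (B (dynScale B D k) + C' / (D - 1)) := by field_simp; ring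
        _ ≤ D * ((1 + C' / (D - 1)) * D ^ k) := by gcongr
        _ = (1 + C' / (D - 1)) * D ^ (k + 1) := by ring
  have := key k
  have : 0 ≤ C' / (D - 1) := div_nonneg hC' hD0.le
  linarith

/-- **The lower bound `D^k ≤ B_{ℓ_k}`** as long as the infima exist: if `B₀ = 1` and the first
`K` infima exist, then `D^k ≤ B_{ℓ_k}` for `k ≤ K`. [cite: AizenmanDuminilCopinAnnals2021, arXiv:1912.07973 §6.1, display D^k ≤ B_{ℓ_k} ≤ CD^k] -/
theorem pow_le_apply_dynScale (hB0 : B 0 = 1) (hD : 0 ≤ D) {K : ℕ}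
    (hK : ∀ k, k < K → ∃ n : ℕ, D * B (dynScale B D k) ≤ B n) {k : ℕ} (hk : k ≤ K) :
    D ^ k ≤ B (dynScale B D k) := by
  induction k with
  | zero => simp [hB0]
  | succ k ih =>
    calc D ^ (k + 1) = D * D ^ k := by ring
      _ ≤ D * B (dynScale B D k) := mul_le_mul_of_nonneg_left (ih (by omega)) hD
      _ ≤ B (dynScale B D (k + 1)) := mul_le_apply_dynScale_succ (hK k (by omega))

/-- **The choice of `K`** ("since `B_{ℓ_k}(β) ≤ CD^k`, we may choose `K ≥ c log B_L(β)` with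
`2ℓ_K ≤ L`"): under the hypotheses of `apply_dynScale_le`, for every integer `L` there is `K`
with `2ℓ_K ≤ L`, the first `K` infima existing, and `B_L ≤ (1 + C'/(D-1) + 2C') D^{K+1}`.
[cite: AizenmanDuminilCopinAnnals2021, arXiv:1912.07973 §6.1, proof of Thm 1.3 (choice of K)] -/
theorem exists_dynScale_le_and_apply_le (hmono : Monotone B) (hB1 : ∀ n, 1 ≤ B n) (hB0 : B 0 = 1)
    {C' : ℝ} (hstep : ∀ n, B (n + 1) ≤ B n + C') (hdouble : ∀ n, B (2 * n) ≤ B n + C')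
    (hD : 1 + C' < D) (L : ℕ) :
    ∃ K : ℕ, 2 * dynScale B D K ≤ L ∧ (∀ k, k < K → ∃ n : ℕ, D * B (dynScale B D k) ≤ B n) ∧
      B L ≤ (1 + C' / (D - 1) + 2 * C') * D ^ (K + 1) := by
  classical
  have hC' : 0 ≤ C' := by
    have := hdouble 0
    simp only [mul_zero] at this
    linarith
  have hD1 : 1 < D := by linarith
  -- the admissible indices: `2ℓ_k ≤ L` and the first `k` infima exist
  set Padm : ℕ → Prop := fun k => 2 * dynScale B D k ≤ L ∧
    ∀ j, j < k → ∃ n : ℕ, D * B (dynScale B D j) ≤ B n with hPadm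
  set K := Nat.findGreatest Padm L with hKdef
  have hK : Padm K :=
    Nat.findGreatest_spec (P := Padm) (Nat.zero_le L) (by simp [hPadm])
  refine ⟨K, hK.1, hK.2, ?_⟩
  have hup := apply_dynScale_le hmono hB1 hB0 hstep hdouble hD K
  have hDk : 0 ≤ D ^ K := pow_nonneg (by linarith) K
  have hD0 : (1 : ℝ) ≤ D ^ (K + 1) := one_le_pow₀ hD1.le
  have hCD : 0 ≤ C' / (D - 1) := div_nonneg hC' (by linarith)
  -- `K + 1` is not admissible
  have hK1 : ¬ Padm (K + 1) := by
    intro hP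
    have hKle : K + 1 ≤ L := by
      have := le_dynScale hmono hB1 hdouble hD (K + 1)
      have := hP.1
      omega
    have := Nat.le_findGreatest (P := Padm) hKle hP
    rw [← hKdef] at this
    omega
  -- either `2ℓ_{K+1} > L`, or the `K`-th infimum does not exist
  by_cases hex : ∃ n : ℕ, D * B (dynScale B D K) ≤ B n
  · have hK1' : L < 2 * dynScale B D (K + 1) := by
      by_contra hle
      push Not at hle
      refine hK1 ⟨hle, fun j hj => ?_⟩
      rcases Nat.lt_succ_iff_lt_or_eq.1 hj with hj | rfl
      · exact hK.2 j hj
      · exact hex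
    -- `B_{⌊L/2⌋} < D B_{ℓ_K}` and `B_L ≤ B_{⌊L/2⌋} + 2C'`
    have hhalf : B (L / 2) < D * B (dynScale B D K) :=
      apply_lt_mul_of_lt_dynScale_succ (by omega)
    have hL : B L ≤ B (L / 2) + 2 * C' := by
      have h1 : B (2 * (L / 2)) ≤ B (L / 2) + C' := hdouble (L / 2)
      have h2 : B (2 * (L / 2) + 1) ≤ B (2 * (L / 2)) + C' := hstep _
      have h3 : B L ≤ B (2 * (L / 2) + 1) := hmono (by omega)
      linarith
    calc B L ≤ D * B (dynScale B D K) + 2 * C' := by linarith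
      _ ≤ D * ((1 + C' / (D - 1)) * D ^ K) + 2 * C' * D ^ (K + 1) := by
          have : 2 * C' ≤ 2 * C' * D ^ (K + 1) := by nlinarith
          nlinarith
      _ = (1 + C' / (D - 1) + 2 * C') * D ^ (K + 1) := by ring
  · -- every `n` fails, in particular `n = L`
    push Not at hex
    have hL := hex L
    calc B L ≤ D * B (dynScale B D K) := hL.le
      _ ≤ D * ((1 + C' / (D - 1)) * D ^ K) := by nlinarith
      _ = (1 + C' / (D - 1)) * D ^ (K + 1) := by ring
      _ ≤ (1 + C' / (D - 1) + 2 * C') * D ^ (K + 1) := by nlinarith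

end Scales

/-! ### Part 5. The bubble diagram of the states `μ ∈ 𝒢(β, 0)`, `β ≤ β_c(4)`: increments -/

section Bubble

/-- **The two-point function of `μ ∈ 𝒢(β,0)`, `0 ≤ β ≤ β_c(4)`**: `μ` is a probability measure and
`∫ σ_xσ_y dμ = ⟨σ₀σ_{y-x}⟩^∅_β` (uniqueness of the Gibbs state below and at `β_c`, theorems of the
tree). [cite: AizenmanDuminilCopinSidoraviciusCMP2015, Thm. 1.2 (continuity/uniqueness at β_c)] -/
theorem isingGibbsMeasure_twoPoint_four {β : ℝ} (hβ : 0 ≤ β) (hβc : β ≤ criticalBeta 4)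
    {μ : Measure (SpinConfig (Site 4))} (hμ : μ ∈ isingGibbsMeasures 4 β 0) :
    IsProbabilityMeasure μ ∧ ∀ x y, ∫ σ, spinAt x σ * spinAt y σ ∂μ = twoPointFree 4 β (y - x) :=
  isingGibbsMeasure_twoPoint_of_facts hasUniqueGibbsMeasure_of_lt_criticalBeta_holds
    hasUniqueGibbsMeasure_criticalBeta_holds (fun d => exists_freeMeasure_holds d 0) (by norm_num) hβ hβc hμ

/-- `S(x) = ⟨σ₀σ_x⟩_μ = ⟨σ₀σ_x⟩^∅_β` for `μ ∈ 𝒢(β,0)`, `0 ≤ β ≤ β_c(4)`. [folklore] -/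
theorem twoPoint_zero_eq_twoPointFree {β : ℝ} (hβ : 0 ≤ β) (hβc : β ≤ criticalBeta 4)
    {μ : Measure (SpinConfig (Site 4))} (hμ : μ ∈ isingGibbsMeasures 4 β 0) (x : Site 4) :
    twoPoint μ spinAt 0 x = twoPointFree 4 β x := by
  have h := (isingGibbsMeasure_twoPoint_four hβ hβc hμ).2 0 x
  rw [sub_zero] at h
  exact h

/-- **Shell bound from the infrared bound** (`d = 4`): there is `C'` with
`∑_{‖v‖_∞ = k+1} ⟨σ₀σ_v⟩^∅_β² ≤ C'/(k+1)` for all `0 ≤ β ≤ β_c` and `k` (the infrared bound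
`⟨σ₀σ_v⟩^∅_{β_c} ≤ C₀‖v‖^{-2}`, Griffiths' monotonicity in `β`, `|∂Λ_{k+1}| ≤ 216 (k+1)³`; ADC
§6.1: "By the Infrared Bound, `B_L - B_ℓ ≤ C₀ log(L/ℓ)` (in dimension `d = 4`)").
[cite: AizenmanDuminilCopinAnnals2021, arXiv:1912.07973 §6.1, "B_L − B_ℓ ≤ C₀ log(L/ℓ)"] -/
theorem exists_sphere_sum_twoPointFree_sq_le :
    ∃ C' : ℝ, 0 ≤ C' ∧ ∀ β : ℝ, 0 ≤ β → β ≤ criticalBeta 4 → ∀ k : ℕ,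
      ∑ v ∈ sphere 4 (k + 1), twoPointFree 4 β v ^ 2 ≤ C' / ((k : ℝ) + 1) := by
  obtain ⟨C₀, hC₀⟩ := twoPointFree_criticalBeta_upper_holds (d := 4) (by norm_num)
  have hlim : hasBoxLimit_isingCorr_free 4 := hasBoxLimit_isingCorr_free_holds
  have hβmono : isingCorr_free_mono_beta (d := 4) := isingCorr_free_mono_beta_of_gks_two
    fun _ _ _ _ _ _ => GKSInequalities.gks_two_holds (zdGraph 4)
  have hgks : ∀ {Λ A : Finset (Site 4)} {β h : ℝ} {bc : BoundaryCondition (Site 4)},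
      gks_one (zdGraph 4) (Λ := Λ) (A := A) (β := β) (h := h) (bc := bc) :=
    GKSInequalities.gks_one_holds (zdGraph 4)
  refine ⟨216 * C₀ ^ 2, by positivity, fun β hβ hβc k => ?_⟩
  have hpt : ∀ v ∈ sphere 4 (k + 1), twoPointFree 4 β v ^ 2 ≤ C₀ ^ 2 / ((k : ℝ) + 1) ^ 4 := by
    intro v hv
    have hvn : Site.supNorm v = k + 1 := mem_sphere.1 hv
    have hv0 : v ≠ 0 := fun h => by rw [h, Site.supNorm_eq_zero_iff.2 rfl] at hvn; omega
    have hnorm : (‖v‖ : ℝ) = (k : ℝ) + 1 := by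
      rw [Site.norm_eq_supNorm, hvn]; push_cast; ring
    have hexp : (‖v‖ : ℝ) ^ (-(((4 : ℕ) : ℝ) - 2)) = (((k : ℝ) + 1) ^ 2)⁻¹ := by
      rw [hnorm, show (-(((4 : ℕ) : ℝ) - 2)) = -(2 : ℝ) by norm_num,
        Real.rpow_neg (by positivity), Real.rpow_two]
    have h0 : 0 ≤ twoPointFree 4 β v := twoPointFree_nonneg hlim hgks hβ v
    have h1 : twoPointFree 4 β v ≤ C₀ / ((k : ℝ) + 1) ^ 2 :=
      calc twoPointFree 4 β v ≤ twoPointFree 4 (criticalBeta 4) v :=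
            twoPointFree_mono_beta hβmono hlim hβ hβc v
        _ ≤ C₀ * (‖v‖ : ℝ) ^ (-(((4 : ℕ) : ℝ) - 2)) := hC₀ v hv0
        _ = C₀ / ((k : ℝ) + 1) ^ 2 := by rw [hexp, div_eq_mul_inv]
    calc twoPointFree 4 β v ^ 2 ≤ (C₀ / ((k : ℝ) + 1) ^ 2) ^ 2 := pow_le_pow_left₀ h0 h1 2
      _ = C₀ ^ 2 / ((k : ℝ) + 1) ^ 4 := by rw [div_pow]; ring
  calc ∑ v ∈ sphere 4 (k + 1), twoPointFree 4 β v ^ 2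
      ≤ ∑ v ∈ sphere 4 (k + 1), C₀ ^ 2 / ((k : ℝ) + 1) ^ 4 := Finset.sum_le_sum hpt
    _ = (#(sphere 4 (k + 1)) : ℝ) * (C₀ ^ 2 / ((k : ℝ) + 1) ^ 4) := by
        rw [Finset.sum_const, nsmul_eq_mul]
    _ ≤ (2 * (4 : ℕ) * (2 * k + 3 : ℝ) ^ (4 - 1)) * (C₀ ^ 2 / ((k : ℝ) + 1) ^ 4) := by
        gcongr
        exact card_sphere_succ_le k
    _ ≤ (8 * (3 * ((k : ℝ) + 1)) ^ 3) * (C₀ ^ 2 / ((k : ℝ) + 1) ^ 4) := by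
        gcongr
        · norm_num
        · linarith
    _ = 216 * C₀ ^ 2 / ((k : ℝ) + 1) := by
        field_simp
        ring

/-- **Increments of the bubble diagram** (`d = 4`): there is `C' ≥ 0` such that for all
`0 ≤ β ≤ β_c`, `μ ∈ 𝒢(β,0)` and integers `n ≤ m`, with `B_n = bubbleDiagram (⟨σ₀σ_·⟩_μ) n`,
`B_m - B_n ≤ (m - n) C'/(n+1)`; in particular `B_{n+1} ≤ B_n + C'` and `B_{2n} ≤ B_n + C'`
(ADC §6.1, "`B_L - B_ℓ ≤ C₀ log(L/ℓ)`", in the weaker form that is used).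
[cite: AizenmanDuminilCopinAnnals2021, arXiv:1912.07973 §6.1, "B_L − B_ℓ ≤ C₀ log(L/ℓ)"] -/
theorem exists_bubbleDiagram_increments :
    ∃ C' : ℝ, 0 ≤ C' ∧ ∀ β : ℝ, 0 ≤ β → β ≤ criticalBeta 4 →
      ∀ μ ∈ isingGibbsMeasures 4 β 0,
        (∀ n : ℕ, bubbleDiagram (twoPoint μ spinAt 0) ((n + 1 : ℕ) : ℝ) ≤
            bubbleDiagram (twoPoint μ spinAt 0) (n : ℝ) + C') ∧
        (∀ n : ℕ, bubbleDiagram (twoPoint μ spinAt 0) ((2 * n : ℕ) : ℝ) ≤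
            bubbleDiagram (twoPoint μ spinAt 0) (n : ℝ) + C') := by
  obtain ⟨C', hC', hshell⟩ := exists_sphere_sum_twoPointFree_sq_le
  refine ⟨C', hC', fun β hβ hβc μ hμ => ?_⟩
  set S : Site 4 → ℝ := twoPoint μ spinAt 0 with hS
  have hSv : ∀ v, S v = twoPointFree 4 β v := fun v => twoPoint_zero_eq_twoPointFree hβ hβc hμ v
  -- `B_m - B_n` as a sum over shells
  have hB : ∀ n : ℕ, bubbleDiagram S (n : ℝ) =
      ∑ m ∈ Finset.range (n + 1), ∑ v ∈ sphere 4 m, S v ^ 2 := fun n => by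
    rw [bubbleDiagram_natCast, sum_box_eq_sum_sphere]
  have hdiff : ∀ n m : ℕ, n ≤ m → bubbleDiagram S (m : ℝ) - bubbleDiagram S (n : ℝ) ≤
      ((m : ℝ) - n) * (C' / ((n : ℝ) + 1)) := by
    intro n m hnm
    rw [hB, hB, ← Finset.sum_range_add_sum_Ico _ (Nat.succ_le_succ hnm), add_sub_cancel_left]
    calc ∑ k ∈ Finset.Ico (n + 1) (m + 1), ∑ v ∈ sphere 4 k, S v ^ 2
        ≤ ∑ k ∈ Finset.Ico (n + 1) (m + 1), C' / ((n : ℝ) + 1) := by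
          refine Finset.sum_le_sum fun k hk => ?_
          rw [Finset.mem_Ico] at hk
          obtain ⟨j, rfl⟩ : ∃ j, k = j + 1 := ⟨k - 1, by omega⟩
          calc ∑ v ∈ sphere 4 (j + 1), S v ^ 2 = ∑ v ∈ sphere 4 (j + 1), twoPointFree 4 β v ^ 2 := by
                simp only [hSv]
            _ ≤ C' / ((j : ℝ) + 1) := hshell β hβ hβc j
            _ ≤ C' / ((n : ℝ) + 1) := by
                apply div_le_div_of_nonneg_left hC' (by positivity)
                have : (n : ℝ) ≤ j := by exact_mod_cast (by omega : n ≤ j)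
                linarith
      _ = ((m : ℝ) - n) * (C' / ((n : ℝ) + 1)) := by
          rw [Finset.sum_const, Nat.card_Ico, nsmul_eq_mul]
          congr 1
          rw [Nat.cast_sub (by omega)]
          push_cast
          ring
  refine ⟨fun n => ?_, fun n => ?_⟩
  · have h := hdiff n (n + 1) (Nat.le_succ n)
    have h2 : (((n + 1 : ℕ) : ℝ) - n) * (C' / ((n : ℝ) + 1)) ≤ C' := by
      push_cast
      rw [show ((n : ℝ) + 1 - n) = 1 by ring, one_mul]
      exact div_le_self hC' (by linarith)
    linarith
  · have h := hdiff n (2 * n) (by omega)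
    have h2 : (((2 * n : ℕ) : ℝ) - n) * (C' / ((n : ℝ) + 1)) ≤ C' := by
      push_cast
      rw [show (2 * (n : ℝ) - n) = n by ring]
      rw [mul_div_assoc']
      exact div_le_of_le_mul₀ (by positivity) hC' (by nlinarith)
    linarith

/-- `B_n` at integer scales is non-decreasing, `≥ 1`, and `B₀ = 1`, for the two-point function of a
probability measure on spin configurations (`S(0) = ⟨σ₀²⟩ = 1`). [folklore] -/
theorem bubbleDiagram_nat_basic (μ : Measure (SpinConfig (Site 4))) [IsProbabilityMeasure μ] :
    Monotone (fun n : ℕ => bubbleDiagram (twoPoint μ spinAt 0) (n : ℝ)) ∧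
      (∀ n : ℕ, 1 ≤ bubbleDiagram (twoPoint μ spinAt 0) (n : ℝ)) ∧
      bubbleDiagram (twoPoint μ spinAt 0) ((0 : ℕ) : ℝ) = 1 := by
  have h0 : twoPoint μ spinAt (0 : Site 4) 0 = 1 := by
    simp only [twoPoint]
    have : ∀ σ : SpinConfig (Site 4), spinAt (0 : Site 4) σ * spinAt 0 σ = 1 := fun σ => by
      rw [← sq, spinAt_sq]
    simp [this]
  refine ⟨fun n m hnm => bubbleDiagram_mono _ (by exact_mod_cast hnm), fun n => ?_, ?_⟩
  · exact one_le_bubbleDiagram h0 (Nat.cast_nonneg n)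
  · rw [bubbleDiagram_natCast, sum_box_zero, h0, one_pow]

end Bubble

/-! ### Part 6. Passage to the infinite-volume states `μ ∈ 𝒢(β, 0)` -/

section InfiniteVolume

/-- **Box-limit passage for the §4.1 reduction** (the step "we work with finite `Λ` and then take
the limit as `Λ` tends to `ℤ^d`" of ADC, here for the improved bound): let `0 ≤ β ≤ β_c(4)`,
`μ ∈ 𝒢(β,0)`, a doubling scale sequence `ℓ`, `K_s`, `r`, and `x : Fin 4 → ℤ⁴`. If for every
`u ∈ ℤ⁴` the finite-volume clustering ratio in `Λ_n` (free b.c.) is eventually at most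
`ε₁ ∏ⱼ ⟨σ_uσ_{xⱼ}⟩^∅_{Λ_n;β}` (`ε₁ ≥ 0`), then
`|U₄^μ(x)| ≤ 2 (ε₁ + 2^{-r}) ∑_u ∏ⱼ ⟨σ_uσ_{xⱼ}⟩_μ` whenever the series converges. Proof: the
finite-volume inequality `abs_connectedFour_free_le_clustering` in `Λ_n`; the hypothesis on the
finitely many `u ∈ Λ_R`, the trivial bound `finVolClusteringRatio ≤ ∏ⱼ⟨σ_uσ_{xⱼ}⟩_{Λ_n}` off `Λ_R`;
`0 ≤ ⟨σ_uσ_{xⱼ}⟩^∅_{Λ_n} ≤ ⟨σ_uσ_{xⱼ}⟩_μ` (Griffiths, volume monotonicity, uniqueness of the state);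
`n → ∞` (box limits of spin monomials), then `R → ∞` (tail of the series).
[cite: AizenmanDuminilCopinAnnals2021, arXiv:1912.07973 §4.1 and §6.1, proof of Thm 1.3; Appendix A.2 ("we work with finite Λ and then take the limit")] -/
theorem abs_connectedFour_le_of_boxClustering {β : ℝ} (hβ : 0 ≤ β) (hβc : β ≤ criticalBeta 4)
    {μ : Measure (SpinConfig (Site 4))} (hμ : μ ∈ isingGibbsMeasures 4 β 0)
    {ℓ : ℕ → ℕ} (h1 : 1 ≤ ℓ 1) (h2 : ∀ k, 2 * ℓ k ≤ ℓ (k + 1)) (Ks r : ℕ) {ε₁ : ℝ} (hε₁ : 0 ≤ ε₁)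
    (x : Fin 4 → Site 4)
    (hcl : ∀ u : Site 4, ∀ᶠ n : ℕ in atTop,
      finVolClusteringRatio (box 4 n) β ℓ Ks (7 * r) (x 0) (x 1) (x 2) (x 3) u ≤
        ε₁ * ∏ j, isingTwoPoint (zdGraph 4) (box 4 n) β 0 .free u (x j))
    (hsum : Summable fun u : Site 4 => ∏ i, twoPoint μ spinAt u (x i)) :
    |connectedFour μ spinAt x| ≤
      2 * (ε₁ + 1 / 2 ^ r) * ∑' u : Site 4, ∏ i, twoPoint μ spinAt u (x i) := by
  classical
  -- `μ` is the translation-invariant free state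
  obtain ⟨μf, hμf, hTI, hcorr⟩ := exists_freeMeasure_holds 4 (β := β) 0 hβ le_rfl
  have huniq : HasUniqueGibbsMeasure (isingSpecification (zdGraph 4) β 0) := by
    rcases hβc.lt_or_eq with hlt | heq
    · exact hasUniqueGibbsMeasure_of_lt_criticalBeta_holds (by norm_num) hβ hlt
    · rw [heq]; exact hasUniqueGibbsMeasure_criticalBeta_holds (by norm_num)
  have hμeq : μ = μf := huniq.1 hμ hμf
  subst hμeq
  haveI : IsProbabilityMeasure μ := hμ.1
  -- box limits of spin monomials in the free state
  have hmon : ∀ {n : ℕ} (z : Fin n → Site 4),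
      Tendsto (fun L : ℕ => ∫ σ, ∏ i, spinAt (z i) σ ∂isingMeasure (zdGraph 4) (box 4 L) β 0 .free)
        atTop (𝓝 (∫ σ, ∏ i, spinAt (z i) σ ∂μ)) := by
    intro n z
    obtain ⟨A, hA⟩ : ∃ A : Finset (Site 4), ∀ σ : SpinConfig (Site 4),
        ∏ i, spinAt (z i) σ = spinProduct A σ := by
      set S : Finset (Site 4) := Finset.univ.image z with hS
      set c : Site 4 → ℕ := fun b => (Finset.univ.filter fun i : Fin n => z i = b).card with hc
      refine ⟨S.filter fun b => Odd (c b), fun σ => ?_⟩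
      rw [spinProduct, Finset.prod_filter,
        Finset.prod_comp (s := (Finset.univ : Finset (Fin n))) (fun b => spinAt b σ) z]
      exact Finset.prod_congr rfl fun b _ => spinAt_pow_eq_ite b σ _
    simp_rw [hA]
    rw [show (∫ σ, spinProduct A σ ∂μ) = freeCorr 4 β 0 A from hcorr A]
    exact hasBoxLimit_isingCorr_free_holds (d := 4) hβ le_rfl A
  -- the two-point function of `μ`
  have htp : ∀ a b : Site 4, twoPoint μ spinAt a b = twoPointFree 4 β (b - a) :=
    (isingGibbsMeasure_twoPoint_four hβ hβc hμ).2
  -- base facts (theorems of the tree)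
  have hgks : ∀ {Λ A : Finset (Site 4)} {β h : ℝ} {bc : BoundaryCondition (Site 4)},
      gks_one (zdGraph 4) (Λ := Λ) (A := A) (β := β) (h := h) (bc := bc) :=
    GKSInequalities.gks_one_holds (zdGraph 4)
  have hlim : hasBoxLimit_isingCorr_free 4 := hasBoxLimit_isingCorr_free_holds
  have hmono : isingCorr_free_mono_volume (d := 4) := isingCorr_free_mono_volume_holds
  have htr : isingTwoPoint_free_translate (d := 4) := isingTwoPoint_free_translate_holds
  -- the right-hand side
  set P : Site 4 → ℝ := fun u => ∏ i, twoPoint μ spinAt u (x i) with hP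
  have hP0 : ∀ u, 0 ≤ P u := fun u => by
    simp only [hP, htp]
    exact Finset.prod_nonneg fun i _ => twoPointFree_nonneg hlim hgks hβ _
  -- finite-volume two-point functions are dominated by `P`
  set Q : ℕ → Site 4 → ℝ := fun L u => ∏ j, isingTwoPoint (zdGraph 4) (box 4 L) β 0 .free u (x j)
    with hQ
  have hQ0 : ∀ L, ∀ u ∈ box 4 L, (∀ i, x i ∈ box 4 L) → 0 ≤ Q L u := fun L u hu hxL =>
    Finset.prod_nonneg fun j _ => isingTwoPoint_free_nonneg hgks hβ hu (hxL j)
  have hQP : ∀ L, ∀ u ∈ box 4 L, (∀ i, x i ∈ box 4 L) → Q L u ≤ P u := by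
    intro L u hu hxL
    simp only [hQ, hP, htp]
    refine Finset.prod_le_prod (fun j _ => isingTwoPoint_free_nonneg hgks hβ hu (hxL j)) fun j _ => ?_
    exact isingTwoPoint_free_le_twoPointFree_sub hmono hlim htr hβ hu (hxL j)
  -- eventually all `x i` lie in the box
  obtain ⟨L₀, hL₀⟩ := exists_forall_subset_box 4 (Finset.univ.image x)
  have hxbox : ∀ L, L₀ ≤ L → ∀ i, x i ∈ box 4 L := fun L hL i =>
    hL₀ L hL (Finset.mem_image_of_mem x (Finset.mem_univ i))
  -- the left-hand side converges
  have hconv : Tendsto (fun L : ℕ => connectedFour (isingMeasure (zdGraph 4) (box 4 L) β 0 .free)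
      spinAt x) atTop (𝓝 (connectedFour μ spinAt x)) := by
    have h4 := hmon x
    have h2' : ∀ a b : Site 4, Tendsto (fun L : ℕ =>
        twoPoint (isingMeasure (zdGraph 4) (box 4 L) β 0 .free) spinAt a b) atTop
        (𝓝 (twoPoint μ spinAt a b)) := by
      intro a b
      have h := hmon ![a, b]
      simp only [Fin.prod_univ_two, Matrix.cons_val_zero, Matrix.cons_val_one] at h
      exact h
    simp only [connectedFour, nPoint]
    exact ((h4.sub ((h2' _ _).mul (h2' _ _))).sub ((h2' _ _).mul (h2' _ _))).sub
      ((h2' _ _).mul (h2' _ _))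
  -- Step 1: for every cut-off `R`, `|U₄^μ(x)| ≤ 2(ε₁ + 2^{-r}) ∑' P + 2 (∑' P - ∑_{Λ_R} P)`
  have hstep : ∀ R : ℕ, |connectedFour μ spinAt x| ≤
      2 * (ε₁ + 1 / 2 ^ r) * (∑' u, P u) + 2 * ((∑' u, P u) - ∑ u ∈ box 4 R, P u) := by
    intro R
    have hclR : ∀ᶠ L : ℕ in atTop, ∀ u ∈ box 4 R,
        finVolClusteringRatio (box 4 L) β ℓ Ks (7 * r) (x 0) (x 1) (x 2) (x 3) u ≤ ε₁ * Q L u :=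
      (box 4 R).eventually_all.2 fun u _ => hcl u
    refine le_of_tendsto hconv.abs ?_
    filter_upwards [hclR, eventually_ge_atTop L₀, eventually_ge_atTop R] with L hL hLL₀ hLR
    have hxL := hxbox L hLL₀
    have hRL : box 4 R ⊆ box 4 L := box_mono 4 hLR
    refine (abs_connectedFour_free_le_clustering hβ (box 4 L) h1 h2 Ks r x hxL).trans ?_
    -- split the clustering ratios at `Λ_R`
    have hsplit : ∑ u ∈ box 4 L, finVolClusteringRatio (box 4 L) β ℓ Ks (7 * r) (x 0) (x 1) (x 2) (x 3) u
        ≤ ε₁ * ∑ u ∈ box 4 L, Q L u + ∑ u ∈ box 4 L \ box 4 R, P u := by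
      rw [← Finset.sum_sdiff hRL]
      have hA : ∑ u ∈ box 4 L \ box 4 R,
          finVolClusteringRatio (box 4 L) β ℓ Ks (7 * r) (x 0) (x 1) (x 2) (x 3) u ≤
          ∑ u ∈ box 4 L \ box 4 R, P u := by
        refine Finset.sum_le_sum fun u hu => ?_
        have huL : u ∈ box 4 L := (Finset.mem_sdiff.1 hu).1
        exact (finVolClusteringRatio_le_prod hβ (box 4 L) ℓ Ks _ x hxL huL).trans (hQP L u huL hxL)
      have hB : ∑ u ∈ box 4 R,
          finVolClusteringRatio (box 4 L) β ℓ Ks (7 * r) (x 0) (x 1) (x 2) (x 3) u ≤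
          ε₁ * ∑ u ∈ box 4 L, Q L u := by
        calc ∑ u ∈ box 4 R, finVolClusteringRatio (box 4 L) β ℓ Ks (7 * r) (x 0) (x 1) (x 2) (x 3) u
            ≤ ∑ u ∈ box 4 R, ε₁ * Q L u := Finset.sum_le_sum fun u hu => hL u hu
          _ = ε₁ * ∑ u ∈ box 4 R, Q L u := by rw [Finset.mul_sum]
          _ ≤ ε₁ * ∑ u ∈ box 4 L, Q L u := by
              refine mul_le_mul_of_nonneg_left ?_ hε₁
              exact Finset.sum_le_sum_of_subset_of_nonneg hRL fun u hu _ => hQ0 L u hu hxL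
      linarith
    have hQsum : ∑ u ∈ box 4 L, Q L u ≤ ∑' u, P u :=
      (Finset.sum_le_sum fun u hu => hQP L u hu hxL).trans (hsum.sum_le_tsum _ fun u _ => hP0 u)
    have hQsum0 : 0 ≤ ∑ u ∈ box 4 L, Q L u := Finset.sum_nonneg fun u hu => hQ0 L u hu hxL
    have htail : ∑ u ∈ box 4 L \ box 4 R, P u ≤ (∑' u, P u) - ∑ u ∈ box 4 R, P u := by
      have := Finset.sum_sdiff hRL (f := P)
      have hL' : ∑ u ∈ box 4 L, P u ≤ ∑' u, P u := hsum.sum_le_tsum _ fun u _ => hP0 u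
      linarith
    have htsum0 : 0 ≤ ∑' u, P u := tsum_nonneg hP0
    calc 2 * ∑ u ∈ box 4 L, (finVolClusteringRatio (box 4 L) β ℓ Ks (7 * r) (x 0) (x 1) (x 2) (x 3) u +
          (1 / 2 ^ r) * Q L u)
        = 2 * (∑ u ∈ box 4 L, finVolClusteringRatio (box 4 L) β ℓ Ks (7 * r) (x 0) (x 1) (x 2) (x 3) u +
            (1 / 2 ^ r) * ∑ u ∈ box 4 L, Q L u) := by
          rw [Finset.sum_add_distrib, Finset.mul_sum]
      _ ≤ 2 * (ε₁ * ∑ u ∈ box 4 L, Q L u + ∑ u ∈ box 4 L \ box 4 R, P u +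
            (1 / 2 ^ r) * ∑ u ∈ box 4 L, Q L u) := by linarith
      _ ≤ 2 * (ε₁ * ∑' u, P u + ((∑' u, P u) - ∑ u ∈ box 4 R, P u) + (1 / 2 ^ r) * ∑' u, P u) := by
          gcongr
      _ = 2 * (ε₁ + 1 / 2 ^ r) * (∑' u, P u) + 2 * ((∑' u, P u) - ∑ u ∈ box 4 R, P u) := by ring
  -- Step 2: `∑_{Λ_R} P → ∑' P` as `R → ∞`
  have hlimR : Tendsto (fun R : ℕ => 2 * (ε₁ + 1 / 2 ^ r) * (∑' u, P u) +
      2 * ((∑' u, P u) - ∑ u ∈ box 4 R, P u)) atTop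
      (𝓝 (2 * (ε₁ + 1 / 2 ^ r) * (∑' u, P u) + 2 * ((∑' u, P u) - ∑' u, P u))) := by
    -- the boxes exhaust `ℤ⁴` (`eventually_subset_box_holds`, as in `Sweep1Proofs.tendsto_box_atTop`)
    have hbox : Tendsto (box 4) atTop atTop := Filter.tendsto_atTop.2 (eventually_subset_box_holds 4)
    have h := hsum.hasSum.comp hbox
    exact tendsto_const_nhds.add ((tendsto_const_nhds.sub h).const_mul 2)
  rw [sub_self, mul_zero, add_zero] at hlimR
  exact ge_of_tendsto' hlimR hstep

end InfiniteVolume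

/-! ### Part 7. Theorem 1.3 from the finite-volume clustering bound -/

section Assembly

/-- Elementary: with `r = ⌊δK/7⌋`, `2^{-δK} + 2^{-r} ≤ 3 · 2^{-δK/7}` (`δK ≥ 0`). [folklore] -/
theorem clusteringFactor_le {t : ℝ} (ht : 0 ≤ t) :
    (2 : ℝ) ^ (-(7 * t)) + 1 / 2 ^ ⌊t⌋₊ ≤ 3 * (2 : ℝ) ^ (-t) := by
  have h2 : (1 : ℝ) ≤ 2 := by norm_num
  have hA : (2 : ℝ) ^ (-(7 * t)) ≤ (2 : ℝ) ^ (-t) :=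
    Real.rpow_le_rpow_of_exponent_le h2 (by linarith)
  have hB : 1 / (2 : ℝ) ^ ⌊t⌋₊ ≤ 2 * (2 : ℝ) ^ (-t) := by
    have hfl : t < ⌊t⌋₊ + 1 := Nat.lt_floor_add_one t
    calc 1 / (2 : ℝ) ^ ⌊t⌋₊ = (2 : ℝ) ^ (-(⌊t⌋₊ : ℝ)) := by
          rw [Real.rpow_neg (by norm_num), Real.rpow_natCast, one_div]
      _ ≤ (2 : ℝ) ^ (1 + -t) := Real.rpow_le_rpow_of_exponent_le h2 (by linarith)
      _ = 2 * (2 : ℝ) ^ (-t) := by rw [Real.rpow_add (by norm_num), Real.rpow_one]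
  linarith

/-- Elementary: if `1 < D`, `0 < M`, `0 < b ≤ M D^{K+1}` and `0 ≤ δ`, then with
`c = δ log 2 / (7 log D)`, `2^{-δK/7} ≤ 2^{δ/7} M^c b^{-c}` — the conversion of "`K ≥ c log B_L`"
into the factor `B_L^{-c}`. [folklore] -/
theorem rpow_neg_scale_le {D M b δ : ℝ} (hD : 1 < D) (hM : 0 < M) (hb : 0 < b) (hδ : 0 ≤ δ) {K : ℕ}
    (hbK : b ≤ M * D ^ (K + 1)) :
    (2 : ℝ) ^ (-(δ * K / 7)) ≤
      (2 : ℝ) ^ (δ / 7) * M ^ (δ * Real.log 2 / (7 * Real.log D)) * b ^ (-(δ * Real.log 2 / (7 * Real.log D))) := by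
  set c : ℝ := δ * Real.log 2 / (7 * Real.log D) with hc
  have hlogD : 0 < Real.log D := Real.log_pos hD
  have hlog2 : 0 < Real.log 2 := Real.log_pos (by norm_num)
  have hc0 : 0 ≤ c := div_nonneg (mul_nonneg hδ hlog2.le) (by positivity)
  -- logarithm of `b ≤ M D^{K+1}`
  have hlogb : Real.log b ≤ Real.log M + (K + 1) * Real.log D := by
    have h := Real.log_le_log hb hbK
    rw [Real.log_mul hM.ne' (by positivity), Real.log_pow] at h
    push_cast at h
    linarith
  rw [Real.rpow_def_of_pos (by norm_num : (0 : ℝ) < 2), Real.rpow_def_of_pos (by norm_num : (0 : ℝ) < 2),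
    Real.rpow_def_of_pos hM, Real.rpow_def_of_pos hb, ← Real.exp_add, ← Real.exp_add, Real.exp_le_exp]
  -- compare exponents: `-(δK/7) log 2 ≤ (δ/7) log 2 + c log M - c log b`
  have key : c * (Real.log b - Real.log M) ≤ Real.log 2 * (δ / 7) * (K + 1) := by
    have h1 : Real.log b - Real.log M ≤ (K + 1) * Real.log D := by linarith
    calc c * (Real.log b - Real.log M) ≤ c * ((K + 1) * Real.log D) :=
          mul_le_mul_of_nonneg_left h1 hc0
      _ = Real.log 2 * (δ / 7) * (K + 1) := by
          rw [hc]; field_simp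
  nlinarith [key]

/-- `∏ᵢ ∫ σ_{xᵢ}σ_u dμ = ∏ᵢ ⟨σ_uσ_{xᵢ}⟩_μ` (commutativity of the product of spins). [folklore] -/
theorem prod_integral_eq_prod_twoPoint (μ : Measure (SpinConfig (Site 4))) (x : Fin 4 → Site 4)
    (u : Site 4) : ∏ i, ∫ σ, spinAt (x i) σ * spinAt u σ ∂μ = ∏ i, twoPoint μ spinAt u (x i) := by
  refine Finset.prod_congr rfl fun i _ => ?_
  simp only [twoPoint]
  congr 1
  funext σ
  ring

/-- The scale sequence of a state: `ℓ_k(β, D)` computed from the bubble diagram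
`B_ℓ = bubbleDiagram (⟨σ₀σ_·⟩_μ) ℓ` of `μ` at integer scales. [cite: AizenmanDuminilCopinAnnals2021, arXiv:1912.07973 §6.1, definition of ℓ_k] -/
def stateScale (μ : Measure (SpinConfig (Site 4))) (D : ℝ) : ℕ → ℕ :=
  dynScale (fun n : ℕ => bubbleDiagram (twoPoint μ spinAt 0) (n : ℝ)) D

/-- **Aizenman–Duminil-Copin 2021, Theorem 1.3 from the intersection-clustering bound (Prop. 6.1)
in finite volume.** There is `D₀` such that for every `D ≥ D₀` and `δ > 0` the following
implication holds. HYPOTHESIS (the finite-volume form of ADC Prop. 6.1, "for `d = 4` and `D`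
large enough, there exists `δ = δ(D) > 0` such that for every `β ≤ β_c`, every `K > 3` with
`ℓ_K ≤ ξ(β)`, and every `u, x, y, z, t ∈ ℤ⁴` with mutual distances between `x, y, z, t` larger
than `2ℓ_K`, `P^{ux,uz,uy,ut}_β[M_u(𝒯; 𝓛, K) < δK] ≤ 2^{-δK}`", read in the free-boundary
boxes `Λ_n`, `n → ∞`, multiplied through by `∏ⱼ ⟨σ_uσ_{xⱼ}⟩_{Λ_n}`, with the scales
`ℓ_k = ℓ_k(β, D)` of §6.1 whose first `K` infima exist): for all `0 ≤ β ≤ β_c(4)`, `K > 3`,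
`μ ∈ 𝒢(β,0)`, if the first `K` infima defining `ℓ_k` exist and `ℓ_K` is in the window
`ℓ_K ≤ ξ(β)`, then for all `x : Fin 4 → ℤ⁴` at mutual sup-distance `> 2ℓ_K`, all `u ∈ ℤ⁴` and
every threshold `θ ≤ δK`, eventually in `n`,
`finVolClusteringRatio Λ_n β ℓ K θ x u ≤ 2^{-δK} ∏ⱼ ⟨σ_uσ_{xⱼ}⟩^∅_{Λ_n;β}`. CONCLUSION: the
tree's named fact `aizenmanDuminilCopin_improvedTreeDiagramBound` (Thm 1.3 for the DLR states).
Proof as printed (§4.1 "Proof of Theorem 1.3" and §6.1 "we follow the same lines …, simply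
noting that since `B_{ℓ_k}(β) ≤ CD^k`, we may choose `K ≥ c log B_L(β)` with `2ℓ_K ≤ L`"): the
§4.1 reduction in `Λ_n` (`abs_connectedFour_free_le_clustering`, with `r = ⌊δK/7⌋`, the
constant `7` being that of the tree's covering lemma), the passage `n → ∞`
(`abs_connectedFour_le_of_boxClustering`), the bounds `B_{ℓ_k} ≤ CD^k` from the infrared bound
(`exists_dynScale_le_and_apply_le`), and the plain tree diagram bound when `K ≤ 3`.
[cite: AizenmanDuminilCopinAnnals2021, arXiv:1912.07973 Thm 1.3 (p. 6), its proof in §4.1 and §6.1, Prop. 6.1] -/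
theorem improvedTreeDiagramBound_of_boxClustering :
    ∃ D₀ : ℝ, 1 < D₀ ∧ ∀ D : ℝ, D₀ ≤ D → ∀ δ : ℝ, 0 < δ →
      (∀ (β : ℝ) (K : ℕ), 0 ≤ β → β ≤ criticalBeta 4 → 3 < K →
        ∀ μ ∈ isingGibbsMeasures 4 β 0,
          (∀ k, k < K → ∃ n : ℕ, D * bubbleDiagram (twoPoint μ spinAt 0) (stateScale μ D k : ℝ) ≤
              bubbleDiagram (twoPoint μ spinAt 0) (n : ℝ)) →
          (β = criticalBeta 4 ∨
            (0 < β ∧ (stateScale μ D K : ℝ) * invCorrLength (twoPointPlus 4 β) ≤ 1)) →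
          ∀ (x : Fin 4 → Site 4) (u : Site 4),
            (∀ i j, i ≠ j → (2 * stateScale μ D K : ℝ) < ‖x i - x j‖) →
            ∀ θ : ℕ, (θ : ℝ) ≤ δ * K →
              ∀ᶠ n : ℕ in atTop,
                finVolClusteringRatio (box 4 n) β (stateScale μ D) K θ (x 0) (x 1) (x 2) (x 3) u ≤
                  (2 : ℝ) ^ (-(δ * K)) * ∏ j, isingTwoPoint (zdGraph 4) (box 4 n) β 0 .free u (x j)) →
      aizenmanDuminilCopin_improvedTreeDiagramBound := by
  obtain ⟨C', hC'0, hincr⟩ := exists_bubbleDiagram_increments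
  refine ⟨2 + C', by linarith, fun D hD δ hδ hclust => ?_⟩
  have hD1 : 1 < D := by linarith
  have hDC : 1 + C' < D := by linarith
  -- the constants
  set c : ℝ := δ * Real.log 2 / (7 * Real.log D) with hc
  set M : ℝ := 1 + C' / (D - 1) + 2 * C' with hM
  have hlogD : 0 < Real.log D := Real.log_pos hD1
  have hlog2 : 0 < Real.log 2 := Real.log_pos (by norm_num)
  have hc0 : 0 < c := div_pos (mul_pos hδ hlog2) (by positivity)
  have hM1 : 1 ≤ M := by
    have : 0 ≤ C' / (D - 1) := div_nonneg hC'0 (by linarith)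
    rw [hM]; linarith
  have hM0 : 0 < M := by linarith
  set Cbig : ℝ := 6 * (2 : ℝ) ^ (δ / 7) * M ^ c + 2 * (M * D ^ 4) ^ c with hCbig
  have hCbig0 : 0 < Cbig := by
    have hA : 0 < 6 * (2 : ℝ) ^ (δ / 7) * M ^ c :=
      mul_pos (mul_pos (by norm_num) (Real.rpow_pos_of_pos zero_lt_two _)) (Real.rpow_pos_of_pos hM0 _)
    have hB : 0 ≤ 2 * (M * D ^ 4) ^ c :=
      mul_nonneg zero_le_two (Real.rpow_nonneg (mul_nonneg hM0.le (pow_nonneg (zero_le_one.trans hD1.le) 4)) _)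
    rw [hCbig]; linarith
  refine ⟨c, Cbig, hc0, hCbig0, fun β L hβ hβc hL hwin μ hμ x hdist hsum => ?_⟩
  haveI : IsProbabilityMeasure μ := (isingGibbsMeasure_twoPoint_four hβ hβc hμ).1
  -- the bubble diagram of `μ` at integer scales and the scales `ℓ_k`
  set B : ℕ → ℝ := fun n => bubbleDiagram (twoPoint μ spinAt 0) (n : ℝ) with hB
  obtain ⟨hBmono, hB1, hB0⟩ := bubbleDiagram_nat_basic μ
  obtain ⟨hstep, hdouble⟩ := hincr β hβ hβc μ hμ
  obtain ⟨h1, h2⟩ := dynScale_doubling (B := B) (D := D) hBmono hB1 hdouble hDC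
  have hℓ : stateScale μ D = dynScale B D := rfl
  -- `B_L = B_{⌊L⌋}`
  have hL'L : ((⌊L⌋₊ : ℕ) : ℝ) ≤ L := Nat.floor_le hL.le
  have hBL : bubbleDiagram (twoPoint μ spinAt 0) L = B ⌊L⌋₊ := by
    simp only [hB, bubbleDiagram, latticeBox_eq_box hL.le, latticeBox_natCast]
  have hBpos : 0 < B ⌊L⌋₊ := by linarith [hB1 ⌊L⌋₊]
  have hBLpos : 0 < bubbleDiagram (twoPoint μ spinAt 0) L := by rw [hBL]; exact hBpos
  -- the choice of `K`
  obtain ⟨K, hK2, hKinf, hKB⟩ :=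
    exists_dynScale_le_and_apply_le (B := B) (D := D) hBmono hB1 hB0 hstep hdouble hDC ⌊L⌋₊
  have hKB' : B ⌊L⌋₊ ≤ M * D ^ (K + 1) := by rw [hM]; exact hKB
  have hK2' : (2 * (dynScale B D K : ℝ)) ≤ L := by
    have h' : ((2 * dynScale B D K : ℕ) : ℝ) ≤ ((⌊L⌋₊ : ℕ) : ℝ) := by exact_mod_cast hK2
    push_cast at h'
    linarith
  -- the right-hand side
  set T : ℝ := ∑' u : Site 4, ∏ i, twoPoint μ spinAt u (x i) with hT
  have htp : ∀ a b : Site 4, twoPoint μ spinAt a b = twoPointFree 4 β (b - a) :=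
    (isingGibbsMeasure_twoPoint_four hβ hβc hμ).2
  have hT0 : 0 ≤ T := by
    refine tsum_nonneg fun u => Finset.prod_nonneg fun i _ => ?_
    rw [htp]
    exact twoPointFree_nonneg hasBoxLimit_isingCorr_free_holds
      (fun {_ _ _ _ _} => GKSInequalities.gks_one_holds (zdGraph 4)) hβ _
  -- the plain tree diagram bound (used when `K ≤ 3`)
  have htree : |connectedFour μ spinAt x| ≤ 2 * T := by
    have hsum' : Summable fun u : Site 4 => ∏ i, ∫ σ, spinAt (x i) σ * spinAt u σ ∂μ := by
      simp_rw [prod_integral_eq_prod_twoPoint]; exact hsum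
    have h := aizenman_treeDiagramBound_three_le (by norm_num) β hβ hβc μ hμ x hsum'
    simp_rw [prod_integral_eq_prod_twoPoint] at h
    exact h
  -- `B_L^{-c}` and the shape of the goal
  set W : ℝ := bubbleDiagram (twoPoint μ spinAt 0) L ^ (-c) with hW
  have hBc : W = (bubbleDiagram (twoPoint μ spinAt 0) L ^ c)⁻¹ := Real.rpow_neg hBLpos.le c
  have hW0 : 0 ≤ W := Real.rpow_nonneg hBLpos.le _
  have hgoal_of : ∀ {A : ℝ}, |connectedFour μ spinAt x| ≤ A * T → A ≤ Cbig * W →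
      |connectedFour μ spinAt x| ≤ Cbig / bubbleDiagram (twoPoint μ spinAt 0) L ^ c * T := by
    intro A hA hAC
    rw [div_eq_mul_inv, ← hBc]
    exact hA.trans (mul_le_mul_of_nonneg_right hAC hT0)
  have hposA : 0 ≤ 6 * (2 : ℝ) ^ (δ / 7) * M ^ c * W :=
    mul_nonneg (mul_nonneg (mul_nonneg (by norm_num) (Real.rpow_nonneg zero_le_two _))
      (Real.rpow_nonneg hM0.le _)) hW0
  have hMD : 0 ≤ M * D ^ 4 := mul_nonneg hM0.le (pow_nonneg (zero_le_one.trans hD1.le) 4)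
  have hposB : 0 ≤ 2 * (M * D ^ 4) ^ c * W :=
    mul_nonneg (mul_nonneg zero_le_two (Real.rpow_nonneg hMD _)) hW0
  by_cases hK3 : K ≤ 3
  · -- few scales: `B_L ≤ M D^4`, the plain tree diagram bound suffices
    refine hgoal_of htree ?_
    have hBL4 : bubbleDiagram (twoPoint μ spinAt 0) L ≤ M * D ^ 4 := by
      rw [hBL]
      exact hKB'.trans (mul_le_mul_of_nonneg_left (pow_le_pow_right₀ hD1.le (by omega)) hM0.le)
    -- `1 ≤ (M D⁴)^c B_L^{-c}`
    have hx1 : 1 ≤ (M * D ^ 4) ^ c * W := by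
      rw [hBc, le_mul_inv_iff₀ (Real.rpow_pos_of_pos hBLpos c), one_mul]
      exact Real.rpow_le_rpow hBLpos.le hBL4 hc0.le
    calc (2 : ℝ) ≤ 6 * (2 : ℝ) ^ (δ / 7) * M ^ c * W + 2 * ((M * D ^ 4) ^ c * W) := by linarith
      _ = Cbig * W := by rw [hCbig]; ring
  · -- many scales: the clustering bound at `K > 3`
    have hK3' : 3 < K := not_le.1 hK3
    -- the hypothesis, instantiated at `K`, threshold `7r`, `r = ⌊δK/7⌋`
    have hwinK : β = criticalBeta 4 ∨
        (0 < β ∧ (stateScale μ D K : ℝ) * invCorrLength (twoPointPlus 4 β) ≤ 1) := by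
      rw [hℓ]
      exact adcWindow_mono hβ hwin (by linarith)
    have hdistK : ∀ i j, i ≠ j → (2 * stateScale μ D K : ℝ) < ‖x i - x j‖ := by
      intro i j hij
      rw [hℓ]
      linarith [hdist i j hij]
    have hθ : ((7 * ⌊δ * K / 7⌋₊ : ℕ) : ℝ) ≤ δ * K := by
      push_cast
      have := Nat.floor_le (show 0 ≤ δ * K / 7 by positivity)
      linarith
    have hcl : ∀ u : Site 4, ∀ᶠ n : ℕ in atTop,
        finVolClusteringRatio (box 4 n) β (dynScale B D) K (7 * ⌊δ * K / 7⌋₊) (x 0) (x 1) (x 2) (x 3) u ≤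
          (2 : ℝ) ^ (-(δ * K)) * ∏ j, isingTwoPoint (zdGraph 4) (box 4 n) β 0 .free u (x j) := by
      intro u
      have h := hclust β K hβ hβc hK3' μ hμ hKinf hwinK x u hdistK (7 * ⌊δ * K / 7⌋₊) hθ
      rw [hℓ] at h
      exact h
    have hmain := abs_connectedFour_le_of_boxClustering hβ hβc hμ h1 h2 K ⌊δ * K / 7⌋₊
      (Real.rpow_nonneg (by norm_num) _) x hcl hsum
    refine hgoal_of hmain ?_
    -- `2 (2^{-δK} + 2^{-r}) ≤ 6 · 2^{-δK/7} ≤ 6 · 2^{δ/7} M^c B_L^{-c} ≤ Cbig B_L^{-c}`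
    have hfac : (2 : ℝ) ^ (-(δ * K)) + 1 / 2 ^ ⌊δ * K / 7⌋₊ ≤ 3 * (2 : ℝ) ^ (-(δ * K / 7)) := by
      have h := clusteringFactor_le (t := δ * K / 7) (by positivity)
      rw [show 7 * (δ * K / 7) = δ * K by ring] at h
      exact h
    have hscale : (2 : ℝ) ^ (-(δ * K / 7)) ≤ (2 : ℝ) ^ (δ / 7) * M ^ c * W := by
      have h := rpow_neg_scale_le (δ := δ) hD1 hM0 hBpos hδ.le hKB'
      rw [hW, hBL, hc]
      exact h
    calc 2 * ((2 : ℝ) ^ (-(δ * K)) + 1 / 2 ^ ⌊δ * K / 7⌋₊) ≤ 6 * (2 : ℝ) ^ (-(δ * K / 7)) := by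
          linarith
      _ ≤ 6 * ((2 : ℝ) ^ (δ / 7) * M ^ c * W) := by linarith
      _ ≤ 6 * ((2 : ℝ) ^ (δ / 7) * M ^ c * W) + 2 * (M * D ^ 4) ^ c * W := by linarith
      _ = Cbig * W := by rw [hCbig]; ring

end Assembly

end Literature.Probability.LatticeModels
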